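import Mathlib.Analysis.Calculus.MeanValue
import Literature.MathematicalPhysics.QuantumLattice.HardCoreBosonOpticalLatticeBEC
import Literature.MathematicalPhysics.QuantumLattice.HardCoreBosonCondensation
import Literature.MathematicalPhysics.QuantumLattice.XXZThermalSpontaneousOrder
import Literature.MathematicalPhysics.QuantumLattice.ApproximatingHamiltonianProofs
import Literature.MathematicalPhysics.QuantumLattice.HeisenbergOrderDLSProofs
import Literature.MathematicalPhysics.QuantumLattice.SpinHalfCasimirBound
import Literature.MathematicalPhysics.QuantumLattice.DuhamelTwoPointProofs
import HarnessLib

/-!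
# Hard-core lattice bosons in a staggered potential: the density is not constant
# (Aizenman–Lieb–Seiringer–Solovej–Yngvason 2004, Theorem 3)

M. Aizenman, E. H. Lieb, R. Seiringer, J. P. Solovej, J. Yngvason, *Bose–Einstein quantum phase
transition in an optical lattice model*, Phys. Rev. A **70** (2004) 023612 (`AizenmanEtAl2004`, §4
Theorem 3 and its proof, eqs. (densstag), (enes), (fircl)–(taylor)) = E. H. Lieb, R. Seiringer,
J. P. Solovej, J. Yngvason, *The Mathematics of the Bose Gas and its Condensation* (`LSSY2005`),
Ch. 11, Theorem 11.4.

The model is the tree's `hardCoreLatticeGas d L λ = H_XY + λ Σ_x (½ + (-1)^x S³_x)` on the torus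
`(ℤ/Lℤ)^d` (`Literature.Barriers.AtomisticToContinuum.HalfFillingReflectionPositivity`), i.e. hard-core
bosons at half filling in the staggered potential `λ(-1)^x` (`n_x = S³_x + ½`). Theorem 1 of the source
(Bose–Einstein condensation for small `λ`, with a CONSTANT condensate wave function) is
`HardCoreBosonOpticalLatticeBEC.lean`; Theorem 3 says that nevertheless the particle DENSITY reacts
linearly to the staggered potential, uniformly in the volume:
`|Λ|⁻¹ |Σ_x (-1)^x ϱ(x)| ≥ λ |e(0)|² / (2d²(3d + λ))`.

## Contents (all statements are theorems; no new definitions, no named facts)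

* §1 `re_state_conj_exp_le_taylor` — the source's Taylor step (fircl)–(taylor) in general form: for a
  positive normalised functional `φ` on `n × n` matrices, Hermitian `C`, `A` and `‖[C,[C,A]]‖ ≤ K`,
  `Re φ(e^{iεC} A e^{-iεC}) ≤ Re φ(A) + ε Re φ(i[C,A]) + ½Kε²` (one-variable Taylor bound with the
  second derivative `-Re φ(e^{iεC}[C,[C,A]]e^{-iεC})` controlled through `‖[C,[C,A]]‖·1 ∓ [C,[C,A]] ⪰ 0`).
* §2 spin-½ bond algebra: the bond current `j_{xy} = S¹_xS²_y - S²_xS¹_y` satisfies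
  `[j_{xy}, S³_x] = -i t_{xy}`, `[j_{xy}, S³_y] = +i t_{xy}` (`t_{xy} = S¹_xS¹_y + S²_xS²_y` the hopping
  term), norms `‖j‖, ‖t‖ ≤ ½`, supports.
* §3 on the even torus, with `c_{x,i} = ½(-1)^x j_{x,x+eᵢ}`: **`[c_{x,i}, W] = -i t_{x,x+eᵢ}`**
  (`dressedCurrent_comm_stagPotential`) — the bond-by-bond form of the source's `[C, W] = iH₀`.
* §4–§5 the generator `C_{i,p} = Σ_{x : x_i ≡ p (2)} c_{x,i}` of one of the `2d` dimer coverings: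
  locality (`[c_{x,i}, Y] = 0` off the dimer, `commute_of_disjoint`), the counting lemma (at most `|S|`
  dimers of a covering meet a set `S`), hence `‖[C_{i,p}, Y]‖ ≤ ½|S|‖Y‖` for `Y` supported on `S`, and
  the two constants of the printed proof: `‖[C_{i,p},[C_{i,p},W]]‖ ≤ ½·#{x : x_i ≡ p}` and
  `‖[C_{i,p},[C_{i,p},H_XY]]‖ ≤ ¾ d |Λ|`.
* §6 **(enes)** `stagPerturb_core` (abstract reference state `φ`: positive, normalised, stationary for
  `H_XY`, zero `3`-magnetisation; conclusion for any lower bound `B` of `Re φ(e^{iεC}H(λ)e^{-iεC})`) and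
  `hardCoreLatticeGas_groundEnergy_le_stagPerturb`:
  `E(λ) ≤ E(0) + ½λ|Λ| - λ² e₀²|Λ|/(2d²(3d+λ))`, `e₀ = E(0)/|Λ|` (`d ≥ 1`, `λ ≥ 0`, torus `(ℤ/2kℤ)^d`,
  `k ≥ 2`): the rotated ground state of `H_XY` as a trial state, Taylor to second order, first-order
  terms `φ([C,H₀]) = 0` and `Σ_{i,p} φ(i[C_{i,p},W]) = φ(-H₀) = -E(0)`, `φ(W) = ½|Λ|`
  (`HardCoreBoson.groundState_spinThree_eq_zero`), average over the `2d` coverings, optimal `ε`.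
  The covering-averaged arrangement reproduces exactly the printed constant `½e₀²d⁻²/(3d+λ)`.
* §7 **Theorem 3 at β = ∞** `hardCoreLatticeGas_staggeredMagnetisation_le` (every ground state `φ`:
  `|Λ|⁻¹Σ_x(-1)^x φ(S³_x) ≤ -λe₀²/(2d²(3d+λ))`, from (enes) and `λφ(W) ≤ E(λ) - E(0)`), the tracial
  ground state `hardCoreLatticeGas_groundState_staggeredMagnetisation_le`, and the printed density form
  `hardCoreLatticeGas_staggeredDensity_abs_ge` (`ϱ(x) = ω(n_x)`, `Σ_x(-1)^x = 0`).
* §8 **Theorem 3 at β < ∞ (as printed)**: `gibbsState_xyTorus_spinThree_eq_zero` (particle–hole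
  symmetry of the Gibbs state of `H_XY`), `hardCoreLatticeGas_freeEnergy_le_stagPerturb` ((enes) for the
  free energy `F_β = -β⁻¹ log Z`, with `e(0,β) = |Λ|⁻¹⟨H_XY⟩_{β,0}`: the rotated Gibbs state of `H_XY`
  in Peierls–Bogoliubov's inequality `log Z(K) - β⟨H - K⟩_K ≤ log Z(H)`, `K = Uᴴ H_XY U`),
  `hardCoreLatticeGas_thermal_staggeredMagnetisation_le` (`|Λ|⁻¹Σ_x(-1)^x⟨S³_x⟩_{β,λ} ≤
  -λe(0,β)²/(2d²(3d+λ))`, chord `λ⟨W⟩_{β,λ} ≤ F_β(λ) - F_β(0)` again by Peierls–Bogoliubov) and the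
  printed density form `hardCoreLatticeGas_thermal_staggeredDensity_abs_ge`.

Scope notes: torus `(ℤ/2kℤ)^d` with `k ≥ 2` (side `≥ 4`, so that bonds are counted once and the
staggered sign is well defined), `d ≥ 1`, `λ > 0` (the bound is odd in `λ` by the sublattice shift),
`0 < β ≤ ∞`. The source's `e(λ,β)` enters only through `e(0,β)`, as printed.
-/

noncomputable section

open scoped Matrix.Norms.L2Operator ComplexOrder MatrixOrder
open Filter Topology Matrix Complex Finset NormedSpace
open Literature.MathematicalPhysics.QuantumLattice Literature.MathematicalPhysics.QuantumLattice.SpinOperators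
  Literature.Probability.LatticeModels Literature.Barriers.AtomisticToContinuum.BoseGas

namespace Literature.MathematicalPhysics.QuantumLattice

/-! ### §1 Taylor's formula to second order for a unitary conjugation (the source's (taylor)) -/

section Taylor

/-- One-variable Taylor bound: `|f''| ≤ M` everywhere gives `f(ε) ≤ f(0) + εf'(0) + ½Mε²`.
[folklore] -/
private theorem taylor_two_upper {f f' f'' : ℝ → ℝ} (hf : ∀ t, HasDerivAt f (f' t) t)
    (hf' : ∀ t, HasDerivAt f' (f'' t) t) {M : ℝ} (hM : ∀ t, |f'' t| ≤ M) (ε : ℝ) :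
    f ε ≤ f 0 + ε * f' 0 + M * ε ^ 2 / 2 := by
  -- `|f'(t) - f'(0)| ≤ M|t|`
  have hlip : ∀ t, |f' t - f' 0| ≤ M * |t| := by
    intro t
    have h := Convex.norm_image_sub_le_of_norm_hasDerivWithin_le (f := f') (f' := f'')
      (s := Set.univ) (fun x _ => (hf' x).hasDerivWithinAt)
      (fun x _ => by rw [Real.norm_eq_abs]; exact hM x) convex_univ (Set.mem_univ 0) (Set.mem_univ t)
    rw [Real.norm_eq_abs, Real.norm_eq_abs, sub_zero] at h
    exact h
  -- the auxiliary function `h(t) = f(t) - f(0) - t f'(0) - M t²/2`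
  set h : ℝ → ℝ := fun t => f t - f 0 - t * f' 0 - M * t ^ 2 / 2 with hh
  have hh' : ∀ t, HasDerivAt h (f' t - f' 0 - M * t) t := by
    intro t
    have h1 := ((hf t).sub_const (f 0)).sub ((hasDerivAt_id t).mul_const (f' 0))
    have h2 := ((hasDerivAt_pow 2 t).const_mul M).div_const 2
    have h3 := h1.sub h2
    refine h3.congr_deriv ?_
    simp only [Nat.cast_ofNat]
    ring
  have hcont : Continuous h := continuous_iff_continuousAt.2 fun t => (hh' t).continuousAt
  have h0 : h 0 = 0 := by simp [hh]
  have goal : h ε ≤ 0 := by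
    rcases lt_trichotomy 0 ε with hε | hε | hε
    · obtain ⟨ξ, hξ, hslope⟩ := exists_hasDerivAt_eq_slope h (fun t => f' t - f' 0 - M * t) hε
        hcont.continuousOn (fun t _ => hh' t)
      have hξ0 : 0 < ξ := hξ.1
      have hder : f' ξ - f' 0 - M * ξ ≤ 0 := by
        have := hlip ξ
        rw [abs_of_pos hξ0] at this
        linarith [le_abs_self (f' ξ - f' 0)]
      rw [h0, sub_zero, sub_zero] at hslope
      have : h ε = ε * (f' ξ - f' 0 - M * ξ) := by
        rw [hslope]; field_simp
      rw [this]
      exact mul_nonpos_of_nonneg_of_nonpos hε.le hder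
    · rw [← hε, h0]
    · obtain ⟨ξ, hξ, hslope⟩ := exists_hasDerivAt_eq_slope h (fun t => f' t - f' 0 - M * t) hε
        hcont.continuousOn (fun t _ => hh' t)
      have hξ0 : ξ < 0 := hξ.2
      have hder : 0 ≤ f' ξ - f' 0 - M * ξ := by
        have := hlip ξ
        rw [abs_of_neg hξ0] at this
        linarith [neg_abs_le (f' ξ - f' 0)]
      rw [h0, zero_sub, zero_sub] at hslope
      -- `hslope : f' ξ - f' 0 - M ξ = (-h ε) / (-ε) = h ε / ε`
      have hne : ε ≠ 0 := ne_of_lt hε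
      have : h ε = ε * (f' ξ - f' 0 - M * ξ) := by
        rw [hslope, neg_div_neg_eq]; field_simp
      rw [this]
      exact mul_nonpos_of_nonpos_of_nonneg hε.le hder
  have : h ε = f ε - f 0 - ε * f' 0 - M * ε ^ 2 / 2 := by simp [hh]
  linarith

variable {n : Type*} [Fintype n] [DecidableEq n]

/-- `‖Y‖·1 ∓ Y ⪰ 0` for Hermitian `Y` (operator norm). [folklore] -/
private theorem psd_norm_smul_one_sub_herm {Y : Matrix n n ℂ} (hY : Y.IsHermitian) :
    ((‖Y‖ : ℂ) • (1 : Matrix n n ℂ) - Y).PosSemidef := by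
  letI : CStarAlgebra (Matrix n n ℂ) := {}
  have hsa : IsSelfAdjoint Y := hY
  have h := IsSelfAdjoint.le_algebraMap_norm_self hsa
  rw [Algebra.algebraMap_eq_smul_one] at h
  rw [← Matrix.nonneg_iff_posSemidef, sub_nonneg]
  convert h using 1
  ext i j
  simp [Matrix.smul_apply, Matrix.one_apply]

/-- `‖Y‖·1 + Y ⪰ 0` for Hermitian `Y`. [folklore] -/
private theorem psd_norm_smul_one_add_herm {Y : Matrix n n ℂ} (hY : Y.IsHermitian) :
    ((‖Y‖ : ℂ) • (1 : Matrix n n ℂ) + Y).PosSemidef := by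
  have h := psd_norm_smul_one_sub_herm hY.neg
  rwa [norm_neg, sub_neg_eq_add] at h

/-- A positive normalised functional is bounded by the norm on conjugated Hermitian elements:
`|Re φ(U Y Uᴴ)| ≤ ‖Y‖` for `U Uᴴ = 1`. [folklore] -/
private theorem abs_re_state_conj_le_norm (φ : Matrix n n ℂ →ₗ[ℂ] ℂ)
    (hP : ∀ X : Matrix n n ℂ, X.PosSemidef → 0 ≤ (φ X).re) (hN : φ 1 = 1)
    {U Y : Matrix n n ℂ} (hU : U * Uᴴ = 1) (hY : Y.IsHermitian) :
    |(φ (U * Y * Uᴴ)).re| ≤ ‖Y‖ := by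
  have h1 : (U * (((‖Y‖ : ℂ) • (1 : Matrix n n ℂ) - Y)) * Uᴴ).PosSemidef :=
    (psd_norm_smul_one_sub_herm hY).mul_mul_conjTranspose_same U
  have h2 : (U * (((‖Y‖ : ℂ) • (1 : Matrix n n ℂ) + Y)) * Uᴴ).PosSemidef :=
    (psd_norm_smul_one_add_herm hY).mul_mul_conjTranspose_same U
  have e1 : U * (((‖Y‖ : ℂ) • (1 : Matrix n n ℂ) - Y)) * Uᴴ = (‖Y‖ : ℂ) • 1 - U * Y * Uᴴ := by
    rw [Matrix.mul_sub, Matrix.sub_mul, Matrix.mul_smul, Matrix.mul_one, Matrix.smul_mul, hU]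
  have e2 : U * (((‖Y‖ : ℂ) • (1 : Matrix n n ℂ) + Y)) * Uᴴ = (‖Y‖ : ℂ) • 1 + U * Y * Uᴴ := by
    rw [Matrix.mul_add, Matrix.add_mul, Matrix.mul_smul, Matrix.mul_one, Matrix.smul_mul, hU]
  rw [e1] at h1
  rw [e2] at h2
  have g1 := hP _ h1
  have g2 := hP _ h2
  rw [map_sub, map_smul, hN, smul_eq_mul, mul_one, Complex.sub_re, Complex.ofReal_re] at g1
  rw [map_add, map_smul, hN, smul_eq_mul, mul_one, Complex.add_re, Complex.ofReal_re] at g2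
  rw [abs_le]
  constructor <;> linarith

/-- The variational principle for a positive normalised functional composed with a unitary
conjugation: `E₀(H) ≤ Re φ(U H Uᴴ)` (`U Uᴴ = 1`). [folklore] -/
private theorem groundEnergy_le_re_state_conj [Nonempty n] (φ : Matrix n n ℂ →ₗ[ℂ] ℂ)
    (hP : ∀ X : Matrix n n ℂ, X.PosSemidef → 0 ≤ (φ X).re) (hN : φ 1 = 1)
    {U H : Matrix n n ℂ} (hU : U * Uᴴ = 1) (hH : H.IsHermitian) :
    H.groundEnergy ≤ (φ (U * H * Uᴴ)).re := by
  have h0 : (H - (H.groundEnergy : ℂ) • (1 : Matrix n n ℂ)).PosSemidef := by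
    have h := posSemidef_sub_groundEnergy hH
    rwa [Algebra.algebraMap_eq_smul_one, RCLike.real_smul_eq_coe_smul (K := ℂ)] at h
  have h1 := hP _ (h0.mul_mul_conjTranspose_same U)
  rw [Matrix.mul_sub, Matrix.sub_mul, Matrix.mul_smul, Matrix.mul_one, Matrix.smul_mul, hU, map_sub,
    map_smul, hN, smul_eq_mul, mul_one, Complex.sub_re, Complex.ofReal_re] at h1
  linarith

/-- `(e^{itC})ᴴ = e^{-itC}` for Hermitian `C` and real `t`. [folklore] -/
private theorem exp_smul_I_conjTranspose {C : Matrix n n ℂ} (hC : C.IsHermitian) (t : ℝ) :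
    (exp (t • (I • C)))ᴴ = exp (t • -(I • C)) := by
  have hXh : (I • C)ᴴ = -(I • C) := by
    rw [conjTranspose_smul, hC.eq, Complex.star_def, Complex.conj_I, neg_smul]
  rw [← exp_conjTranspose, conjTranspose_smul, hXh]
  simp

/-- `e^{itC} e^{-itC} = 1`. [folklore] -/
private theorem exp_smul_I_mul_exp_neg (C : Matrix n n ℂ) (t : ℝ) :
    exp (t • (I • C)) * exp (t • -(I • C)) = 1 := by
  rw [← Matrix.exp_add_of_commute _ _ ((((Commute.refl (I • C)).neg_right.smul_right t).smul_left t)),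
    smul_neg, add_neg_cancel, NormedSpace.exp_zero]

/-- **Taylor's formula for a unitary conjugation, second order** (the source's (fircl)–(taylor):
"`F_A(ε) = e^{iεC}Ae^{-iεC}` ... `F_A(ε) ≤ F_A(0) + εF'_A(0) + ½ε² sup‖F''_A‖` ... the last norm is
given by the norm of the double commutator `[C,[C,A]]`"), in expectation in a positive normalised
functional `φ`: for Hermitian `C`, `A` with `‖[C,[C,A]]‖ ≤ K`,
`Re φ(e^{iεC} A e^{-iεC}) ≤ Re φ(A) + ε Re φ(i[C,A]) + ½Kε²` for every real `ε`.
[cite: AizenmanEtAl2004, §4 (fircl)–(taylor)] -/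
theorem re_state_conj_exp_le_taylor [Nonempty n] (φ : Matrix n n ℂ →ₗ[ℂ] ℂ)
    (hP : ∀ X : Matrix n n ℂ, X.PosSemidef → 0 ≤ (φ X).re) (hN : φ 1 = 1)
    {C A : Matrix n n ℂ} (hC : C.IsHermitian) (hA : A.IsHermitian) {K : ℝ}
    (hK : ‖C * (C * A - A * C) - (C * A - A * C) * C‖ ≤ K) (ε : ℝ) :
    (φ (exp (ε • (I • C)) * A * exp (ε • -(I • C)))).re ≤
      (φ A).re + ε * (φ (I • (C * A - A * C))).re + K * ε ^ 2 / 2 := by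
  set X : Matrix n n ℂ := I • C with hX
  -- `X` is skew-Hermitian, so `exp(t(-X)) = (exp(tX))ᴴ` and `exp(tX) exp(t(-X)) = 1`
  have hXh : Xᴴ = -X := by
    rw [hX, conjTranspose_smul, hC.eq, Complex.star_def, Complex.conj_I, neg_smul]
  have hconj : ∀ t : ℝ, (exp (t • X))ᴴ = exp (t • -X) := by
    intro t
    rw [← exp_conjTranspose, conjTranspose_smul, hXh]
    simp
  have hUU : ∀ t : ℝ, exp (t • X) * exp (t • -X) = 1 := by
    intro t
    rw [← Matrix.exp_add_of_commute _ _ (((Commute.refl X).neg_right.smul_right t).smul_left t), smul_neg,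
      add_neg_cancel, NormedSpace.exp_zero]
  -- the commutators
  set D₁ : Matrix n n ℂ := X * A - A * X with hD₁
  set D₂ : Matrix n n ℂ := X * D₁ - D₁ * X with hD₂
  have hD₂eq : D₂ = -(C * (C * A - A * C) - (C * A - A * C) * C) := by
    simp only [hD₂, hD₁, hX, Matrix.smul_mul, Matrix.mul_smul, smul_sub, smul_smul, I_mul_I, Matrix.mul_sub,
      Matrix.sub_mul]
    simp only [neg_smul, one_smul, neg_sub_neg]
    abel
  have hCA : (C * A - A * C)ᴴ = -(C * A - A * C) := by
    rw [conjTranspose_sub, conjTranspose_mul, conjTranspose_mul, hC.eq, hA.eq, neg_sub]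
  have hDC : (C * (C * A - A * C) - (C * A - A * C) * C).IsHermitian := by
    rw [IsHermitian, conjTranspose_sub, conjTranspose_mul, conjTranspose_mul, hCA, hC.eq]
    rw [Matrix.mul_neg, Matrix.neg_mul, neg_sub_neg]
  have hD₂h : D₂.IsHermitian := by rw [hD₂eq]; exact hDC.neg
  have hD₂norm : ‖D₂‖ ≤ K := by rw [hD₂eq, norm_neg]; exact hK
  -- commutation of `X` with the exponentials
  have hcomm : ∀ t : ℝ, exp (t • -X) * X = X * exp (t • -X) := fun t =>
    (((Commute.refl X).neg_left.smul_left t).exp_left).eq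
  -- the conjugated family and its derivatives
  set M : ℝ → Matrix n n ℂ := fun t => exp (t • X) * A * exp (t • -X) with hM
  set M' : ℝ → Matrix n n ℂ := fun t => exp (t • X) * D₁ * exp (t • -X) with hM'
  set M'' : ℝ → Matrix n n ℂ := fun t => exp (t • X) * D₂ * exp (t • -X) with hM''
  have hderiv : ∀ (B : Matrix n n ℂ) (t : ℝ), HasDerivAt (fun s : ℝ => exp (s • X) * B * exp (s • -X))
      (exp (t • X) * (X * B - B * X) * exp (t • -X)) t := by
    intro B t
    have h1 : HasDerivAt (fun s : ℝ => exp (s • X)) (exp (t • X) * X) t := hasDerivAt_exp_smul_const X t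
    have h2 : HasDerivAt (fun s : ℝ => exp (s • -X)) (exp (t • -X) * -X) t := hasDerivAt_exp_smul_const (-X) t
    have h := (h1.mul_const B).mul h2
    refine h.congr_deriv ?_
    rw [Matrix.mul_neg, hcomm t]
    simp only [Matrix.mul_sub, Matrix.sub_mul, Matrix.mul_assoc, Matrix.mul_neg]
    abel
  have hM1 : ∀ t, HasDerivAt M (M' t) t := fun t => by
    simpa only [hM, hM', hD₁] using hderiv A t
  have hM2 : ∀ t, HasDerivAt M' (M'' t) t := fun t => by
    simpa only [hM', hM'', hD₂] using hderiv D₁ t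
  -- pass to the real-valued function `g = Re φ ∘ M`
  set φR : Matrix n n ℂ →L[ℝ] ℝ :=
    Complex.reCLM.comp ((φ.restrictScalars ℝ).toContinuousLinearMap) with hφR
  have hφR : ∀ Y, φR Y = (φ Y).re := fun Y => rfl
  set g : ℝ → ℝ := fun t => (φ (M t)).re with hg
  set g' : ℝ → ℝ := fun t => (φ (M' t)).re with hg'
  set g'' : ℝ → ℝ := fun t => (φ (M'' t)).re with hg''
  have hg1 : ∀ t, HasDerivAt g (g' t) t := by
    intro t
    have h := φR.hasFDerivAt.comp_hasDerivAt t (hM1 t)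
    simpa only [hg, hg', Function.comp_def, hφR] using h
  have hg2 : ∀ t, HasDerivAt g' (g'' t) t := by
    intro t
    have h := φR.hasFDerivAt.comp_hasDerivAt t (hM2 t)
    simpa only [hg', hg'', Function.comp_def, hφR] using h
  -- `|g''| ≤ K`
  have hbound : ∀ t, |g'' t| ≤ K := by
    intro t
    have h := abs_re_state_conj_le_norm φ hP hN (U := exp (t • X)) (Y := D₂)
      (by rw [hconj t]; exact hUU t) hD₂h
    rw [hconj t] at h
    exact h.trans hD₂norm
  have htaylor := taylor_two_upper hg1 hg2 hbound ε
  -- identify the terms at `t = 0`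
  have hg0 : g 0 = (φ A).re := by
    simp only [hg, hM, zero_smul, NormedSpace.exp_zero, Matrix.one_mul, Matrix.mul_one]
  have hg'0 : g' 0 = (φ (I • (C * A - A * C))).re := by
    simp only [hg', hM', hD₁, hX, zero_smul, NormedSpace.exp_zero, Matrix.one_mul, Matrix.mul_one, Matrix.smul_mul,
      Matrix.mul_smul, smul_sub]
  have hgε : g ε = (φ (exp (ε • (I • C)) * A * exp (ε • -(I • C)))).re := rfl
  rw [← hgε, ← hg0, ← hg'0]
  linarith

end Taylor

/-! ### §2 The bond current `j_{xy} = S¹_xS²_y - S²_xS¹_y` and the hopping term `t_{xy} = S¹_xS¹_y + S²_xS²_y` (spin ½) -/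

section Local

variable {Λ : Type*} [Fintype Λ] [DecidableEq Λ]

/-- `[j_{xy}, S³_x] = -i t_{xy}` for `x ≠ y` (spin ½): the bond current generates the hopping term
from the staggered field (the source's "`[C,W] = iH₀`", bond by bond).
[cite: AizenmanEtAl2004, §4 proof of Theorem 3] -/
theorem bondCurrent_comm_spinThree_left {x y : Λ} (hxy : x ≠ y) :
    (siteSpin 1 x 0 * siteSpin 1 y 1 - siteSpin 1 x 1 * siteSpin 1 y 0 : Op Λ 2) * siteSpin 1 x 2 -
        siteSpin 1 x 2 * (siteSpin 1 x 0 * siteSpin 1 y 1 - siteSpin 1 x 1 * siteSpin 1 y 0) =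
      -(I • (siteSpin 1 x 0 * siteSpin 1 y 0 + siteSpin 1 x 1 * siteSpin 1 y 1)) := by
  have c1 : (siteSpin 1 y 1 : Op Λ 2) * siteSpin 1 x 2 = siteSpin 1 x 2 * siteSpin 1 y 1 :=
    (siteSpin_commute_of_ne_holds 1 hxy.symm 1 2).eq
  have c0 : (siteSpin 1 y 0 : Op Λ 2) * siteSpin 1 x 2 = siteSpin 1 x 2 * siteSpin 1 y 0 :=
    (siteSpin_commute_of_ne_holds 1 hxy.symm 0 2).eq
  have t1 : (siteSpin 1 x 0 * siteSpin 1 y 1 : Op Λ 2) * siteSpin 1 x 2 =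
      -((I / 2) • (siteSpin 1 x 1 * siteSpin 1 y 1)) := by
    rw [Matrix.mul_assoc, c1, ← Matrix.mul_assoc, siteSpin_one_x_mul_z, Matrix.neg_mul, Matrix.smul_mul]
  have t2 : (siteSpin 1 x 1 * siteSpin 1 y 0 : Op Λ 2) * siteSpin 1 x 2 =
      (I / 2) • (siteSpin 1 x 0 * siteSpin 1 y 0) := by
    rw [Matrix.mul_assoc, c0, ← Matrix.mul_assoc, siteSpin_one_y_mul_z, Matrix.smul_mul]
  have t3 : (siteSpin 1 x 2 : Op Λ 2) * (siteSpin 1 x 0 * siteSpin 1 y 1) =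
      (I / 2) • (siteSpin 1 x 1 * siteSpin 1 y 1) := by
    rw [← Matrix.mul_assoc, siteSpin_one_z_mul_x, Matrix.smul_mul]
  have t4 : (siteSpin 1 x 2 : Op Λ 2) * (siteSpin 1 x 1 * siteSpin 1 y 0) =
      -((I / 2) • (siteSpin 1 x 0 * siteSpin 1 y 0)) := by
    rw [← Matrix.mul_assoc, siteSpin_one_z_mul_y, Matrix.neg_mul, Matrix.smul_mul]
  rw [Matrix.sub_mul, Matrix.mul_sub, t1, t2, t3, t4]
  module

/-- `[j_{xy}, S³_y] = +i t_{xy}` for `x ≠ y` (spin ½). [cite: AizenmanEtAl2004, §4 proof of Theorem 3] -/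
theorem bondCurrent_comm_spinThree_right {x y : Λ} (hxy : x ≠ y) :
    (siteSpin 1 x 0 * siteSpin 1 y 1 - siteSpin 1 x 1 * siteSpin 1 y 0 : Op Λ 2) * siteSpin 1 y 2 -
        siteSpin 1 y 2 * (siteSpin 1 x 0 * siteSpin 1 y 1 - siteSpin 1 x 1 * siteSpin 1 y 0) =
      I • (siteSpin 1 x 0 * siteSpin 1 y 0 + siteSpin 1 x 1 * siteSpin 1 y 1) := by
  have c0 : (siteSpin 1 y 2 : Op Λ 2) * siteSpin 1 x 0 = siteSpin 1 x 0 * siteSpin 1 y 2 :=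
    (siteSpin_commute_of_ne_holds 1 hxy.symm 2 0).eq
  have c1 : (siteSpin 1 y 2 : Op Λ 2) * siteSpin 1 x 1 = siteSpin 1 x 1 * siteSpin 1 y 2 :=
    (siteSpin_commute_of_ne_holds 1 hxy.symm 2 1).eq
  have t1 : (siteSpin 1 x 0 * siteSpin 1 y 1 : Op Λ 2) * siteSpin 1 y 2 =
      (I / 2) • (siteSpin 1 x 0 * siteSpin 1 y 0) := by
    rw [Matrix.mul_assoc, siteSpin_one_y_mul_z, Matrix.mul_smul]
  have t2 : (siteSpin 1 x 1 * siteSpin 1 y 0 : Op Λ 2) * siteSpin 1 y 2 =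
      -((I / 2) • (siteSpin 1 x 1 * siteSpin 1 y 1)) := by
    rw [Matrix.mul_assoc, siteSpin_one_x_mul_z, Matrix.mul_neg, Matrix.mul_smul]
  have t3 : (siteSpin 1 y 2 : Op Λ 2) * (siteSpin 1 x 0 * siteSpin 1 y 1) =
      -((I / 2) • (siteSpin 1 x 0 * siteSpin 1 y 0)) := by
    rw [← Matrix.mul_assoc, c0, Matrix.mul_assoc, siteSpin_one_z_mul_y, Matrix.mul_neg, Matrix.mul_smul]
  have t4 : (siteSpin 1 y 2 : Op Λ 2) * (siteSpin 1 x 1 * siteSpin 1 y 0) =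
      (I / 2) • (siteSpin 1 x 1 * siteSpin 1 y 1) := by
    rw [← Matrix.mul_assoc, c1, Matrix.mul_assoc, siteSpin_one_z_mul_x, Matrix.mul_smul]
  rw [Matrix.sub_mul, Matrix.mul_sub, t1, t2, t3, t4]
  module

/-- `[j_{xy}, S³_z] = 0` for `z ∉ {x, y}`. [cite: AizenmanEtAl2004, §4 proof of Theorem 3] -/
theorem bondCurrent_comm_spinThree_other {x y z : Λ} (hzx : z ≠ x) (hzy : z ≠ y) :
    (siteSpin 1 x 0 * siteSpin 1 y 1 - siteSpin 1 x 1 * siteSpin 1 y 0 : Op Λ 2) * siteSpin 1 z 2 -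
        siteSpin 1 z 2 * (siteSpin 1 x 0 * siteSpin 1 y 1 - siteSpin 1 x 1 * siteSpin 1 y 0) = 0 := by
  have hc : ∀ (w : Λ) (hw : z ≠ w) (α : Fin 3), (siteSpin 1 w α : Op Λ 2) * siteSpin 1 z 2 =
      siteSpin 1 z 2 * siteSpin 1 w α := fun w hw α => (siteSpin_commute_of_ne_holds 1 hw.symm α 2).eq
  rw [Matrix.sub_mul, Matrix.mul_sub, Matrix.mul_assoc, hc y hzy 1, ← Matrix.mul_assoc, hc x hzx 0,
    Matrix.mul_assoc, Matrix.mul_assoc (siteSpin 1 x 1), hc y hzy 0, ← Matrix.mul_assoc (siteSpin 1 x 1),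
    hc x hzx 1, Matrix.mul_assoc, sub_self]

/-- The bond current `j_{xy}` is Hermitian (`x ≠ y`). [cite: AizenmanEtAl2004, §4 proof of Theorem 3] -/
theorem bondCurrent_isHermitian {x y : Λ} (hxy : x ≠ y) :
    (siteSpin 1 x 0 * siteSpin 1 y 1 - siteSpin 1 x 1 * siteSpin 1 y 0 : Op Λ 2).IsHermitian := by
  have h01 : (siteSpin 1 x 0 * siteSpin 1 y 1 : Op Λ 2).IsHermitian := by
    rw [IsHermitian, conjTranspose_mul, (siteSpin_isHermitian 1 x 0).eq, (siteSpin_isHermitian 1 y 1).eq]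
    exact (siteSpin_commute_of_ne_holds 1 hxy.symm 1 0).eq
  have h10 : (siteSpin 1 x 1 * siteSpin 1 y 0 : Op Λ 2).IsHermitian := by
    rw [IsHermitian, conjTranspose_mul, (siteSpin_isHermitian 1 x 1).eq, (siteSpin_isHermitian 1 y 0).eq]
    exact (siteSpin_commute_of_ne_holds 1 hxy.symm 0 1).eq
  exact h01.sub h10

/-- The hopping term `t_{xy}` is Hermitian (`x ≠ y`). [cite: AizenmanEtAl2004, §2 (2.1)] -/
theorem bondHopping_isHermitian {x y : Λ} (hxy : x ≠ y) :
    (siteSpin 1 x 0 * siteSpin 1 y 0 + siteSpin 1 x 1 * siteSpin 1 y 1 : Op Λ 2).IsHermitian := by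
  have h0 : (siteSpin 1 x 0 * siteSpin 1 y 0 : Op Λ 2).IsHermitian := by
    rw [IsHermitian, conjTranspose_mul, (siteSpin_isHermitian 1 x 0).eq, (siteSpin_isHermitian 1 y 0).eq]
    exact (siteSpin_commute_of_ne_holds 1 hxy.symm 0 0).eq
  have h1 : (siteSpin 1 x 1 * siteSpin 1 y 1 : Op Λ 2).IsHermitian := by
    rw [IsHermitian, conjTranspose_mul, (siteSpin_isHermitian 1 x 1).eq, (siteSpin_isHermitian 1 y 1).eq]
    exact (siteSpin_commute_of_ne_holds 1 hxy.symm 1 1).eq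
  exact h0.add h1

/-- `‖S^α_x S^β_y‖ ≤ ¼` for spin ½ (operator norm). [folklore] -/
private theorem norm_siteSpin_mul_le (x y : Λ) (α β : Fin 3) :
    ‖(siteSpin 1 x α * siteSpin 1 y β : Op Λ 2)‖ ≤ 1 / 4 := by
  have hx := XXZKT.norm_siteSpin_le_half 1 x α
  have hy := XXZKT.norm_siteSpin_le_half 1 y β
  simp only [Nat.cast_one] at hx hy
  calc ‖(siteSpin 1 x α * siteSpin 1 y β : Op Λ 2)‖ ≤ ‖(siteSpin 1 x α : Op Λ 2)‖ * ‖(siteSpin 1 y β : Op Λ 2)‖ :=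
        norm_mul_le _ _
    _ ≤ (1 / 2) * (1 / 2) := mul_le_mul hx hy (norm_nonneg _) (by norm_num)
    _ = 1 / 4 := by norm_num

/-- `‖j_{xy}‖ ≤ ½`. [cite: AizenmanEtAl2004, §4 proof of Theorem 3] -/
theorem norm_bondCurrent_le (x y : Λ) :
    ‖(siteSpin 1 x 0 * siteSpin 1 y 1 - siteSpin 1 x 1 * siteSpin 1 y 0 : Op Λ 2)‖ ≤ 1 / 2 := by
  have h := norm_sub_le (siteSpin 1 x 0 * siteSpin 1 y 1 : Op Λ 2) (siteSpin 1 x 1 * siteSpin 1 y 0)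
  linarith [norm_siteSpin_mul_le x y 0 1, norm_siteSpin_mul_le x y 1 0]

/-- `‖t_{xy}‖ ≤ ½`. [cite: AizenmanEtAl2004, §4 proof of Theorem 3] -/
theorem norm_bondHopping_le (x y : Λ) :
    ‖(siteSpin 1 x 0 * siteSpin 1 y 0 + siteSpin 1 x 1 * siteSpin 1 y 1 : Op Λ 2)‖ ≤ 1 / 2 := by
  have h := norm_add_le (siteSpin 1 x 0 * siteSpin 1 y 0 : Op Λ 2) (siteSpin 1 x 1 * siteSpin 1 y 1)
  linarith [norm_siteSpin_mul_le x y 0 0, norm_siteSpin_mul_le x y 1 1]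

/-- `‖[X, Y]‖ ≤ 2‖X‖‖Y‖`. [folklore] -/
private theorem norm_comm_le (X Y : Op Λ 2) : ‖X * Y - Y * X‖ ≤ 2 * ‖X‖ * ‖Y‖ := by
  have h := norm_sub_le (X * Y) (Y * X)
  have h1 := norm_mul_le X Y
  have h2 := norm_mul_le Y X
  linarith

/-- A product of two spins is supported on the pair of sites. [folklore] -/
private theorem isSupportedOn_siteSpin_mul (x y : Λ) (α β : Fin 3) {S : Finset Λ} (hx : x ∈ S) (hy : y ∈ S) :
    IsSupportedOn (siteSpin 1 x α * siteSpin 1 y β : Op Λ 2) S :=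
  IsSupportedOn.mul_holds (IsSupportedOn.mono_holds (isSupportedOn_onSite_holds x _) (by simpa using hx))
    (IsSupportedOn.mono_holds (isSupportedOn_onSite_holds y _) (by simpa using hy))

/-- The bond current is supported on `{x, y}` (any `S ∋ x, y`). [folklore] -/
private theorem isSupportedOn_bondCurrent (x y : Λ) {S : Finset Λ} (hx : x ∈ S) (hy : y ∈ S) :
    IsSupportedOn (siteSpin 1 x 0 * siteSpin 1 y 1 - siteSpin 1 x 1 * siteSpin 1 y 0 : Op Λ 2) S := by
  rw [sub_eq_add_neg, ← neg_one_smul ℂ (siteSpin 1 x 1 * siteSpin 1 y 0 : Op Λ 2)]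
  exact (isSupportedOn_siteSpin_mul x y 0 1 hx hy).add ((isSupportedOn_siteSpin_mul x y 1 0 hx hy).smul _)

/-- The hopping term is supported on `{x, y}` (any `S ∋ x, y`). [folklore] -/
private theorem isSupportedOn_bondHopping (x y : Λ) {S : Finset Λ} (hx : x ∈ S) (hy : y ∈ S) :
    IsSupportedOn (siteSpin 1 x 0 * siteSpin 1 y 0 + siteSpin 1 x 1 * siteSpin 1 y 1 : Op Λ 2) S :=
  (isSupportedOn_siteSpin_mul x y 0 0 hx hy).add (isSupportedOn_siteSpin_mul x y 1 1 hx hy)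

/-- Support calculus for commutators: `[A, B]` is supported on any common support. [folklore] -/
private theorem isSupportedOn_comm {A B : Op Λ 2} {S : Finset Λ} (hA : IsSupportedOn A S) (hB : IsSupportedOn B S) :
    IsSupportedOn (A * B - B * A) S := by
  rw [sub_eq_add_neg, ← neg_one_smul ℂ (B * A)]
  exact (IsSupportedOn.mul_holds hA hB).add ((IsSupportedOn.mul_holds hB hA).smul _)

/-- Locality: operators with disjoint supports commute. [folklore] -/
private theorem comm_eq_zero_of_disjoint {A B : Op Λ 2} {X Y : Finset Λ} (hA : IsSupportedOn A X)
    (hB : IsSupportedOn B Y) (h : Disjoint X Y) : A * B - B * A = 0 :=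
  sub_eq_zero.2 (commute_of_disjoint_holds hA hB h).eq

end Local

/-! ### §3 The even torus: staggered signs, the dressed bond current `c_{x,i} = ½(-1)^x j_{x,x+eᵢ}` and `[c_{x,i}, W] = -i t_{x,x+eᵢ}` -/

section Torus

variable {d : ℕ}

/-- Neighbours carry opposite staggered signs on the even torus: `(-1)^{x+eᵢ} = -(-1)^x`.
[cite: LSSY2005, Ch. 11 (11.2)] -/
private theorem stag_add_single {k : ℕ} [NeZero (2 * k)] (x : TorusSite d (2 * k)) (i : Fin d) :
    (-1 : ℝ) ^ (∑ j, ((x + Pi.single i 1 : TorusSite d (2 * k)) j).val) = -(-1 : ℝ) ^ (∑ j, (x j).val) := by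
  have h := stagger_mul_stagger_add_single k x i
  set s := (-1 : ℝ) ^ (∑ j, (x j).val)
  set t := (-1 : ℝ) ^ (∑ j, ((x + Pi.single i 1 : TorusSite d (2 * k)) j).val)
  have hsq : s * s = 1 := by rw [← pow_add, ← two_mul, pow_mul, neg_one_sq, one_pow]
  calc t = s * s * t := by rw [hsq, one_mul]
    _ = s * (s * t) := by ring
    _ = -s := by rw [h]; ring

/-- `((-1)^x)² = 1`. [folklore] -/
private theorem stag_mul_self {L : ℕ} (x : TorusSite d L) :
    (-1 : ℝ) ^ (∑ j, (x j).val) * (-1 : ℝ) ^ (∑ j, (x j).val) = 1 := by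
  rw [← pow_add, ← two_mul, pow_mul, neg_one_sq, one_pow]

/-- `x ≠ x + eᵢ` on a torus of side `2k ≥ 2`. [folklore] -/
private theorem ne_add_single {k : ℕ} [NeZero (2 * k)] (hk : 1 ≤ k) (x : TorusSite d (2 * k)) (i : Fin d) :
    x ≠ x + Pi.single i 1 := fun h =>
  single_ne_zero_of_two_le (2 * k) (by omega) i (by simpa using h.symm)

/-- The hard-core lattice gas with real-cast staggered signs:
`H = H_XY + λ Σ_x (½ + (-1)^x S³_x)`. [cite: AizenmanEtAl2004, §2 (2.1)] -/
theorem hardCoreLatticeGas_eq_real (L : ℕ) [NeZero L] (lam : ℝ) :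
    hardCoreLatticeGas d L lam = xyTorus d L 1 + (lam : ℂ) •
      ∑ x : TorusSite d L, ((1 / 2 : ℂ) • (1 : Op (TorusSite d L) 2) +
        (((-1 : ℝ) ^ (∑ j, (x j).val) : ℝ) : ℂ) • siteSpin 1 x 2) := by
  rw [hardCoreLatticeGas_eq]
  congr 2
  refine Finset.sum_congr rfl fun x _ => ?_
  push_cast
  rfl

/-- **`[c_{x,i}, W] = -i t_{x,x+eᵢ}`** on the even torus, `W = Σ_z (½ + (-1)^z S³_z)` the staggered
potential and `c_{x,i} = ½(-1)^x j_{x,x+eᵢ}`: the bond-by-bond form of the source's `[C, W] = iH₀`.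
[cite: AizenmanEtAl2004, §4 proof of Theorem 3] -/
theorem dressedCurrent_comm_stagPotential {k : ℕ} [NeZero (2 * k)] (hk : 1 ≤ k) (x : TorusSite d (2 * k))
    (i : Fin d) :
    ((((-1 : ℝ) ^ (∑ j, (x j).val) / 2 : ℝ) : ℂ) •
          (siteSpin 1 x 0 * siteSpin 1 (x + Pi.single i 1) 1 - siteSpin 1 x 1 * siteSpin 1 (x + Pi.single i 1) 0 :
            Op (TorusSite d (2 * k)) 2)) *
        (∑ z : TorusSite d (2 * k), ((1 / 2 : ℂ) • (1 : Op (TorusSite d (2 * k)) 2) +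
          (((-1 : ℝ) ^ (∑ j, (z j).val) : ℝ) : ℂ) • siteSpin 1 z 2)) -
      (∑ z : TorusSite d (2 * k), ((1 / 2 : ℂ) • (1 : Op (TorusSite d (2 * k)) 2) +
          (((-1 : ℝ) ^ (∑ j, (z j).val) : ℝ) : ℂ) • siteSpin 1 z 2)) *
        ((((-1 : ℝ) ^ (∑ j, (x j).val) / 2 : ℝ) : ℂ) •
          (siteSpin 1 x 0 * siteSpin 1 (x + Pi.single i 1) 1 - siteSpin 1 x 1 * siteSpin 1 (x + Pi.single i 1) 0)) =
      -(I • (siteSpin 1 x 0 * siteSpin 1 (x + Pi.single i 1) 0 + siteSpin 1 x 1 * siteSpin 1 (x + Pi.single i 1) 1)) := by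
  set y : TorusSite d (2 * k) := x + Pi.single i 1 with hy
  have hxy : x ≠ y := ne_add_single hk x i
  set σ : TorusSite d (2 * k) → ℝ := fun z => (-1 : ℝ) ^ (∑ j, (z j).val) with hσ
  have hσy : σ y = -σ x := stag_add_single x i
  set A : Op (TorusSite d (2 * k)) 2 := siteSpin 1 x 0 * siteSpin 1 y 1 - siteSpin 1 x 1 * siteSpin 1 y 0 with hA
  set h : Op (TorusSite d (2 * k)) 2 := siteSpin 1 x 0 * siteSpin 1 y 0 + siteSpin 1 x 1 * siteSpin 1 y 1 with hh
  set w : TorusSite d (2 * k) → Op (TorusSite d (2 * k)) 2 := fun z =>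
    (1 / 2 : ℂ) • (1 : Op (TorusSite d (2 * k)) 2) + ((σ z : ℝ) : ℂ) • siteSpin 1 z 2 with hw
  show (((σ x / 2 : ℝ) : ℂ) • A) * (∑ z, w z) - (∑ z, w z) * (((σ x / 2 : ℝ) : ℂ) • A) = -(I • h)
  -- per-site commutators
  have hz : ∀ z, A * w z - w z * A = ((σ z : ℝ) : ℂ) • (A * siteSpin 1 z 2 - siteSpin 1 z 2 * A) := by
    intro z
    simp only [hw, Matrix.mul_add, Matrix.add_mul, Matrix.mul_smul, Matrix.smul_mul, Matrix.mul_one,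
      Matrix.one_mul, smul_sub]
    abel
  have hcomm : A * (∑ z, w z) - (∑ z, w z) * A = ∑ z, (A * w z - w z * A) := by
    rw [Finset.mul_sum, Finset.sum_mul, ← Finset.sum_sub_distrib]
  have hsum : ∑ z, (A * w z - w z * A) = ((-(2 * σ x) : ℝ) : ℂ) • (I • h) := by
    rw [Finset.sum_eq_add x y hxy (fun z _ hz' => by
      rw [hz z, hA, bondCurrent_comm_spinThree_other hz'.1 hz'.2, smul_zero])
      (fun hx' => (hx' (Finset.mem_univ _)).elim) (fun hy' => (hy' (Finset.mem_univ _)).elim)]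
    rw [hz x, hz y, hA, bondCurrent_comm_spinThree_left hxy, bondCurrent_comm_spinThree_right hxy, hσy, ← hh]
    rw [smul_neg, ← neg_smul, ← add_smul]
    congr 1
    push_cast
    ring
  rw [Matrix.smul_mul, Matrix.mul_smul, ← smul_sub, hcomm, hsum, smul_smul]
  have hc : ((σ x / 2 : ℝ) : ℂ) * ((-(2 * σ x) : ℝ) : ℂ) = -1 := by
    have h1 : σ x * σ x = 1 := stag_mul_self x
    have h1' : ((σ x : ℝ) : ℂ) * ((σ x : ℝ) : ℂ) = 1 := by exact_mod_cast h1
    push_cast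
    linear_combination (-1 : ℂ) * h1'
  rw [hc, neg_one_smul]

/-! ### §4 The dimer generator `C_{i,p} = Σ_{x : x_i ≡ p (2)} c_{x,i}`: hermiticity, `[C_{i,p}, W]`, locality and norm bounds -/

/-- The dressed bond current is supported on its bond. [folklore] -/
private theorem isSupportedOn_dressedCurrent {L : ℕ} [NeZero L] (x : TorusSite d L) (i : Fin d) {S : Finset (TorusSite d L)}
    (hx : x ∈ S) (hy : x + Pi.single i 1 ∈ S) :
    IsSupportedOn ((((-1 : ℝ) ^ (∑ j, (x j).val) / 2 : ℝ) : ℂ) •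
      (siteSpin 1 x 0 * siteSpin 1 (x + Pi.single i 1) 1 - siteSpin 1 x 1 * siteSpin 1 (x + Pi.single i 1) 0 :
        Op (TorusSite d L) 2)) S :=
  (isSupportedOn_bondCurrent x _ hx hy).smul _

/-- `‖c_{x,i}‖ ≤ ¼`. [cite: AizenmanEtAl2004, §4 proof of Theorem 3] -/
private theorem norm_dressedCurrent_le {L : ℕ} [NeZero L] (x : TorusSite d L) (i : Fin d) :
    ‖(((-1 : ℝ) ^ (∑ j, (x j).val) / 2 : ℝ) : ℂ) •
      (siteSpin 1 x 0 * siteSpin 1 (x + Pi.single i 1) 1 - siteSpin 1 x 1 * siteSpin 1 (x + Pi.single i 1) 0 :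
        Op (TorusSite d L) 2)‖ ≤ 1 / 4 := by
  rw [norm_smul, Complex.norm_real, Real.norm_eq_abs, abs_div, abs_neg_one_pow, abs_two]
  have h := norm_bondCurrent_le x (x + Pi.single i 1)
  have h0 := norm_nonneg (siteSpin 1 x 0 * siteSpin 1 (x + Pi.single i 1) 1 -
    siteSpin 1 x 1 * siteSpin 1 (x + Pi.single i 1) 0 : Op (TorusSite d L) 2)
  nlinarith

/-- Parity flips along a bond of the even torus: `(a + 1).val` and `a.val` have opposite parities in
`ℤ/2kℤ`, `k ≥ 1`. [folklore] -/
private theorem val_add_one_mod_two_ne {k : ℕ} [NeZero (2 * k)] (hk : 1 ≤ k) (a : ZMod (2 * k)) :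
    (a + 1).val % 2 ≠ a.val % 2 := by
  have hlt := a.val_lt
  rw [ZMod.val_add, ZMod.val_one_eq_one_mod, Nat.mod_eq_of_lt (show 1 < 2 * k by omega)]
  by_cases h : a.val + 1 < 2 * k
  · rw [Nat.mod_eq_of_lt h]; omega
  · have he : a.val + 1 = 2 * k := by omega
    rw [he, Nat.mod_self]; omega

/-- **Counting**: among the sites `x` with `x_i ≡ p (2)` at most `|S|` have their dimer `{x, x+eᵢ}`
meeting a given set `S` (each site lies in exactly one such dimer). [folklore] -/
private theorem card_filter_touch_le {k : ℕ} [NeZero (2 * k)] (hk : 1 ≤ k) (i : Fin d) (p : ℕ)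
    (S : Finset (TorusSite d (2 * k))) :
    (Finset.univ.filter (fun x : TorusSite d (2 * k) =>
        (x i).val % 2 = p ∧ (x ∈ S ∨ x + Pi.single i 1 ∈ S))).card ≤ S.card := by
  classical
  set root : TorusSite d (2 * k) → TorusSite d (2 * k) := fun s =>
    if (s i).val % 2 = p then s else s - Pi.single i 1 with hroot
  refine (Finset.card_le_card (t := S.image root) ?_).trans Finset.card_image_le
  intro x hx
  rw [Finset.mem_filter] at hx
  obtain ⟨-, hpar, hS⟩ := hx
  rw [Finset.mem_image]
  rcases hS with hxS | hyS
  · exact ⟨x, hxS, by rw [hroot]; dsimp only; rw [if_pos hpar]⟩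
  · refine ⟨x + Pi.single i 1, hyS, ?_⟩
    have hne : ((x + Pi.single i 1 : TorusSite d (2 * k)) i).val % 2 ≠ p := by
      rw [Pi.add_apply, Pi.single_eq_same, ← hpar]
      exact val_add_one_mod_two_ne hk (x i)
    rw [hroot]; dsimp only; rw [if_neg hne, add_sub_cancel_right]

/-- **Locality expansion**: `[C_{i,p}, Y] = Σ_{x : x_i ≡ p, {x,x+eᵢ} ∩ S ≠ ∅} [c_{x,i}, Y]` for `Y`
supported on `S`. [cite: AizenmanEtAl2004, §4 proof of Theorem 3] -/
private theorem dimerGen_comm_eq_sum_filter {k : ℕ} [NeZero (2 * k)] (i : Fin d) (p : ℕ)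
    {Y : Op (TorusSite d (2 * k)) 2} {S : Finset (TorusSite d (2 * k))} (hY : IsSupportedOn Y S) :
    (∑ x : TorusSite d (2 * k), if (x i).val % 2 = p then
        (((-1 : ℝ) ^ (∑ j, (x j).val) / 2 : ℝ) : ℂ) •
          (siteSpin 1 x 0 * siteSpin 1 (x + Pi.single i 1) 1 - siteSpin 1 x 1 * siteSpin 1 (x + Pi.single i 1) 0 :
            Op (TorusSite d (2 * k)) 2) else 0) * Y -
      Y * (∑ x : TorusSite d (2 * k), if (x i).val % 2 = p then
        (((-1 : ℝ) ^ (∑ j, (x j).val) / 2 : ℝ) : ℂ) •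
          (siteSpin 1 x 0 * siteSpin 1 (x + Pi.single i 1) 1 - siteSpin 1 x 1 * siteSpin 1 (x + Pi.single i 1) 0 :
            Op (TorusSite d (2 * k)) 2) else 0) =
      ∑ x ∈ (Finset.univ.filter (fun y : TorusSite d (2 * k) =>
          (y i).val % 2 = p ∧ (y ∈ S ∨ y + Pi.single i 1 ∈ S))),
        (((((-1 : ℝ) ^ (∑ j, (x j).val) / 2 : ℝ) : ℂ) •
            (siteSpin 1 x 0 * siteSpin 1 (x + Pi.single i 1) 1 - siteSpin 1 x 1 * siteSpin 1 (x + Pi.single i 1) 0 :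
              Op (TorusSite d (2 * k)) 2)) * Y -
          Y * ((((-1 : ℝ) ^ (∑ j, (x j).val) / 2 : ℝ) : ℂ) •
            (siteSpin 1 x 0 * siteSpin 1 (x + Pi.single i 1) 1 - siteSpin 1 x 1 * siteSpin 1 (x + Pi.single i 1) 0 :
              Op (TorusSite d (2 * k)) 2))) := by
  classical
  set c : TorusSite d (2 * k) → Op (TorusSite d (2 * k)) 2 := fun x =>
    (((-1 : ℝ) ^ (∑ j, (x j).val) / 2 : ℝ) : ℂ) •
      (siteSpin 1 x 0 * siteSpin 1 (x + Pi.single i 1) 1 - siteSpin 1 x 1 * siteSpin 1 (x + Pi.single i 1) 0)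
    with hc
  show (∑ x, if (x i).val % 2 = p then c x else 0) * Y - Y * (∑ x, if (x i).val % 2 = p then c x else 0) =
    ∑ x ∈ (Finset.univ.filter (fun y => (y i).val % 2 = p ∧ (y ∈ S ∨ y + Pi.single i 1 ∈ S))), (c x * Y - Y * c x)
  have h1 : (∑ x, if (x i).val % 2 = p then c x else 0) * Y - Y * (∑ x, if (x i).val % 2 = p then c x else 0) =
      ∑ x, if (x i).val % 2 = p then (c x * Y - Y * c x) else 0 := by
    rw [Finset.sum_mul, Finset.mul_sum, ← Finset.sum_sub_distrib]
    refine Finset.sum_congr rfl fun x _ => ?_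
    split_ifs
    · rfl
    · rw [Matrix.zero_mul, Matrix.mul_zero, sub_zero]
  rw [h1, Finset.sum_filter]
  refine Finset.sum_congr rfl fun x _ => ?_
  by_cases hpar : (x i).val % 2 = p
  · by_cases ht : x ∈ S ∨ x + Pi.single i 1 ∈ S
    · rw [if_pos hpar, if_pos ⟨hpar, ht⟩]
    · rw [if_pos hpar, if_neg (fun h => ht h.2)]
      rw [not_or] at ht
      have hdisj : Disjoint ({x, x + Pi.single i 1} : Finset (TorusSite d (2 * k))) S := by
        rw [Finset.disjoint_insert_left, Finset.disjoint_singleton_left]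
        exact ⟨ht.1, ht.2⟩
      exact comm_eq_zero_of_disjoint (isSupportedOn_dressedCurrent x i (by simp) (by simp)) hY hdisj
  · rw [if_neg hpar, if_neg (fun h => hpar h.1)]

/-- **Locality norm bound**: `‖[C_{i,p}, Y]‖ ≤ |S|·‖Y‖/2` for `Y` supported on `S` (at most `|S|`
dimers meet `S`, each contributing `2·¼·‖Y‖`). [cite: AizenmanEtAl2004, §4 proof of Theorem 3] -/
private theorem norm_dimerGen_comm_le {k : ℕ} [NeZero (2 * k)] (hk : 1 ≤ k) (i : Fin d) (p : ℕ)
    {Y : Op (TorusSite d (2 * k)) 2} {S : Finset (TorusSite d (2 * k))} (hY : IsSupportedOn Y S) :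
    ‖(∑ x : TorusSite d (2 * k), if (x i).val % 2 = p then
        (((-1 : ℝ) ^ (∑ j, (x j).val) / 2 : ℝ) : ℂ) •
          (siteSpin 1 x 0 * siteSpin 1 (x + Pi.single i 1) 1 - siteSpin 1 x 1 * siteSpin 1 (x + Pi.single i 1) 0 :
            Op (TorusSite d (2 * k)) 2) else 0) * Y -
      Y * (∑ x : TorusSite d (2 * k), if (x i).val % 2 = p then
        (((-1 : ℝ) ^ (∑ j, (x j).val) / 2 : ℝ) : ℂ) •
          (siteSpin 1 x 0 * siteSpin 1 (x + Pi.single i 1) 1 - siteSpin 1 x 1 * siteSpin 1 (x + Pi.single i 1) 0 :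
            Op (TorusSite d (2 * k)) 2) else 0)‖ ≤ S.card * ‖Y‖ / 2 := by
  rw [dimerGen_comm_eq_sum_filter i p hY]
  refine (norm_sum_le _ _).trans ?_
  have hterm : ∀ x ∈ (Finset.univ.filter (fun y : TorusSite d (2 * k) =>
      (y i).val % 2 = p ∧ (y ∈ S ∨ y + Pi.single i 1 ∈ S))),
      ‖((((-1 : ℝ) ^ (∑ j, (x j).val) / 2 : ℝ) : ℂ) •
            (siteSpin 1 x 0 * siteSpin 1 (x + Pi.single i 1) 1 - siteSpin 1 x 1 * siteSpin 1 (x + Pi.single i 1) 0 :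
              Op (TorusSite d (2 * k)) 2)) * Y -
          Y * ((((-1 : ℝ) ^ (∑ j, (x j).val) / 2 : ℝ) : ℂ) •
            (siteSpin 1 x 0 * siteSpin 1 (x + Pi.single i 1) 1 - siteSpin 1 x 1 * siteSpin 1 (x + Pi.single i 1) 0 :
              Op (TorusSite d (2 * k)) 2))‖ ≤ ‖Y‖ / 2 := by
    intro x _
    refine (norm_comm_le _ _).trans ?_
    have h := norm_dressedCurrent_le x i
    have h0 := norm_nonneg Y
    nlinarith
  refine (Finset.sum_le_sum hterm).trans ?_
  rw [Finset.sum_const, nsmul_eq_mul]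
  have hc := card_filter_touch_le hk i p S
  have h0 := norm_nonneg Y
  have : ((Finset.univ.filter (fun x : TorusSite d (2 * k) =>
      (x i).val % 2 = p ∧ (x ∈ S ∨ x + Pi.single i 1 ∈ S))).card : ℝ) ≤ S.card := by exact_mod_cast hc
  nlinarith

/-! ### §5 The dimer generator against the staggered potential and against `H_XY`: the constants `K_W`, `K_H` -/

/-- The dimer generator `C_{i,p}` is Hermitian. [cite: AizenmanEtAl2004, §4 proof of Theorem 3] -/
private theorem dimerGen_isHermitian {k : ℕ} [NeZero (2 * k)] (hk : 1 ≤ k) (i : Fin d) (p : ℕ) :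
    (∑ x : TorusSite d (2 * k), if (x i).val % 2 = p then
        (((-1 : ℝ) ^ (∑ j, (x j).val) / 2 : ℝ) : ℂ) •
          (siteSpin 1 x 0 * siteSpin 1 (x + Pi.single i 1) 1 - siteSpin 1 x 1 * siteSpin 1 (x + Pi.single i 1) 0 :
            Op (TorusSite d (2 * k)) 2) else 0).IsHermitian := by
  rw [IsHermitian, conjTranspose_sum]
  refine Finset.sum_congr rfl fun x _ => ?_
  split_ifs
  · rw [conjTranspose_smul, (bondCurrent_isHermitian (ne_add_single hk x i)).eq]
    congr 1
    rw [Complex.star_def, Complex.conj_ofReal]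
  · rw [conjTranspose_zero]

/-- **`[C_{i,p}, W] = -i T_{i,p}`**, `T_{i,p} = Σ_{x : x_i ≡ p} t_{x,x+eᵢ}` the hopping on the dimers.
[cite: AizenmanEtAl2004, §4 proof of Theorem 3] -/
private theorem dimerGen_comm_stagPotential {k : ℕ} [NeZero (2 * k)] (hk : 1 ≤ k) (i : Fin d) (p : ℕ) :
    (∑ x : TorusSite d (2 * k), if (x i).val % 2 = p then
        (((-1 : ℝ) ^ (∑ j, (x j).val) / 2 : ℝ) : ℂ) •
          (siteSpin 1 x 0 * siteSpin 1 (x + Pi.single i 1) 1 - siteSpin 1 x 1 * siteSpin 1 (x + Pi.single i 1) 0 :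
            Op (TorusSite d (2 * k)) 2) else 0) *
        (∑ z : TorusSite d (2 * k), ((1 / 2 : ℂ) • (1 : Op (TorusSite d (2 * k)) 2) +
          (((-1 : ℝ) ^ (∑ j, (z j).val) : ℝ) : ℂ) • siteSpin 1 z 2)) -
      (∑ z : TorusSite d (2 * k), ((1 / 2 : ℂ) • (1 : Op (TorusSite d (2 * k)) 2) +
          (((-1 : ℝ) ^ (∑ j, (z j).val) : ℝ) : ℂ) • siteSpin 1 z 2)) *
        (∑ x : TorusSite d (2 * k), if (x i).val % 2 = p then
          (((-1 : ℝ) ^ (∑ j, (x j).val) / 2 : ℝ) : ℂ) •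
            (siteSpin 1 x 0 * siteSpin 1 (x + Pi.single i 1) 1 - siteSpin 1 x 1 * siteSpin 1 (x + Pi.single i 1) 0 :
              Op (TorusSite d (2 * k)) 2) else 0) =
      -(I • ∑ x : TorusSite d (2 * k), if (x i).val % 2 = p then
        (siteSpin 1 x 0 * siteSpin 1 (x + Pi.single i 1) 0 + siteSpin 1 x 1 * siteSpin 1 (x + Pi.single i 1) 1 :
          Op (TorusSite d (2 * k)) 2) else 0) := by
  classical
  set W : Op (TorusSite d (2 * k)) 2 := ∑ z : TorusSite d (2 * k), ((1 / 2 : ℂ) • (1 : Op (TorusSite d (2 * k)) 2) +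
    (((-1 : ℝ) ^ (∑ j, (z j).val) : ℝ) : ℂ) • siteSpin 1 z 2) with hW
  rw [Finset.sum_mul, Finset.mul_sum, ← Finset.sum_sub_distrib, Finset.smul_sum, ← Finset.sum_neg_distrib]
  refine Finset.sum_congr rfl fun x _ => ?_
  split_ifs
  · exact dressedCurrent_comm_stagPotential hk x i
  · rw [Matrix.zero_mul, Matrix.mul_zero, sub_zero, smul_zero, neg_zero]

/-- **`K_W`**: `‖[C_{i,p}, [C_{i,p}, W]]‖ ≤ ½ · #{x : x_i ≡ p}` (each dimer hopping term `t_{x,x+eᵢ}`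
meets at most the two dimers at its sites). [cite: AizenmanEtAl2004, §4 proof of Theorem 3] -/
private theorem norm_dimerGen_dcomm_stagPotential_le {k : ℕ} [NeZero (2 * k)] (hk : 1 ≤ k) (i : Fin d) (p : ℕ) :
    let C : Op (TorusSite d (2 * k)) 2 := ∑ x : TorusSite d (2 * k), if (x i).val % 2 = p then
        (((-1 : ℝ) ^ (∑ j, (x j).val) / 2 : ℝ) : ℂ) •
          (siteSpin 1 x 0 * siteSpin 1 (x + Pi.single i 1) 1 - siteSpin 1 x 1 * siteSpin 1 (x + Pi.single i 1) 0 :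
            Op (TorusSite d (2 * k)) 2) else 0
    let W : Op (TorusSite d (2 * k)) 2 := ∑ z : TorusSite d (2 * k), ((1 / 2 : ℂ) • (1 : Op (TorusSite d (2 * k)) 2) +
          (((-1 : ℝ) ^ (∑ j, (z j).val) : ℝ) : ℂ) • siteSpin 1 z 2)
    ‖C * (C * W - W * C) - (C * W - W * C) * C‖ ≤
      (∑ x : TorusSite d (2 * k), if (x i).val % 2 = p then (1 : ℝ) else 0) / 2 := by
  classical
  intro C W
  have hcomm : C * W - W * C = -(I • ∑ x : TorusSite d (2 * k), if (x i).val % 2 = p then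
      (siteSpin 1 x 0 * siteSpin 1 (x + Pi.single i 1) 0 + siteSpin 1 x 1 * siteSpin 1 (x + Pi.single i 1) 1 :
        Op (TorusSite d (2 * k)) 2) else 0) := dimerGen_comm_stagPotential hk i p
  set T : TorusSite d (2 * k) → Op (TorusSite d (2 * k)) 2 := fun x =>
    siteSpin 1 x 0 * siteSpin 1 (x + Pi.single i 1) 0 + siteSpin 1 x 1 * siteSpin 1 (x + Pi.single i 1) 1 with hT
  have hY : C * (C * W - W * C) - (C * W - W * C) * C =
      -(I • ∑ x, if (x i).val % 2 = p then (C * T x - T x * C) else 0) := by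
    rw [hcomm, Matrix.mul_neg, Matrix.neg_mul, Matrix.mul_smul, Matrix.smul_mul, sub_neg_eq_add, neg_add_eq_sub,
      ← smul_sub, ← neg_sub, smul_neg, Finset.mul_sum, Finset.sum_mul, ← Finset.sum_sub_distrib]
    congr 2
    refine Finset.sum_congr rfl fun x _ => ?_
    split_ifs
    · rfl
    · rw [Matrix.mul_zero, Matrix.zero_mul, sub_zero]
  rw [hY, norm_neg, norm_smul, Complex.norm_I, one_mul]
  refine (norm_sum_le _ _).trans ?_
  rw [Finset.sum_div]
  refine Finset.sum_le_sum fun x _ => ?_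
  split_ifs
  · have hsupp : IsSupportedOn (T x) ({x, x + Pi.single i 1} : Finset (TorusSite d (2 * k))) :=
      isSupportedOn_bondHopping x (x + Pi.single i 1) (by simp) (by simp)
    have h := norm_dimerGen_comm_le hk i p hsupp
    refine h.trans ?_
    have hc : (({x, x + Pi.single i 1} : Finset (TorusSite d (2 * k))).card : ℝ) ≤ 2 := by
      exact_mod_cast Finset.card_le_two
    have hn : ‖T x‖ ≤ 1 / 2 := norm_bondHopping_le x (x + Pi.single i 1)
    have h0 := norm_nonneg (T x)
    nlinarith
  · rw [norm_zero, zero_div]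

/-- **`K_H`, one bond**: `‖[C_{i,p}, [C_{i,p}, t_{z,z+e_j}]]‖ ≤ ¾` (at most two dimers meet the bond,
and at most three meet a dimer together with the bond). [cite: AizenmanEtAl2004, §4 proof of Theorem 3] -/
private theorem norm_dimerGen_dcomm_hop_le {k : ℕ} [NeZero (2 * k)] (hk : 1 ≤ k) (i : Fin d) (p : ℕ)
    (z : TorusSite d (2 * k)) (j : Fin d) :
    let C : Op (TorusSite d (2 * k)) 2 := ∑ x : TorusSite d (2 * k), if (x i).val % 2 = p then
        (((-1 : ℝ) ^ (∑ j, (x j).val) / 2 : ℝ) : ℂ) •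
          (siteSpin 1 x 0 * siteSpin 1 (x + Pi.single i 1) 1 - siteSpin 1 x 1 * siteSpin 1 (x + Pi.single i 1) 0 :
            Op (TorusSite d (2 * k)) 2) else 0
    let T : Op (TorusSite d (2 * k)) 2 :=
      siteSpin 1 z 0 * siteSpin 1 (z + Pi.single j 1) 0 + siteSpin 1 z 1 * siteSpin 1 (z + Pi.single j 1) 1
    ‖C * (C * T - T * C) - (C * T - T * C) * C‖ ≤ 3 / 4 := by
  classical
  intro C T
  set B : Finset (TorusSite d (2 * k)) := {z, z + Pi.single j 1} with hB
  have hTsupp : IsSupportedOn T B := isSupportedOn_bondHopping z (z + Pi.single j 1) (by simp [hB]) (by simp [hB])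
  set c : TorusSite d (2 * k) → Op (TorusSite d (2 * k)) 2 := fun x =>
    (((-1 : ℝ) ^ (∑ j, (x j).val) / 2 : ℝ) : ℂ) •
      (siteSpin 1 x 0 * siteSpin 1 (x + Pi.single i 1) 1 - siteSpin 1 x 1 * siteSpin 1 (x + Pi.single i 1) 0)
    with hc
  set F := Finset.univ.filter (fun y : TorusSite d (2 * k) => (y i).val % 2 = p ∧ (y ∈ B ∨ y + Pi.single i 1 ∈ B))
    with hF
  have h1 : C * T - T * C = ∑ x ∈ F, (c x * T - T * c x) := dimerGen_comm_eq_sum_filter i p hTsupp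
  have h2 : C * (C * T - T * C) - (C * T - T * C) * C = ∑ x ∈ F, (C * (c x * T - T * c x) - (c x * T - T * c x) * C) := by
    rw [h1, Finset.mul_sum, Finset.sum_mul, ← Finset.sum_sub_distrib]
  rw [h2]
  refine (norm_sum_le _ _).trans ?_
  -- each term: `[c_x, T]` is supported on `B ∪ {x, x+eᵢ}`, of cardinality `≤ 3`, and has norm `≤ ¼`
  have hterm : ∀ x ∈ F, ‖C * (c x * T - T * c x) - (c x * T - T * c x) * C‖ ≤ 3 / 8 := by
    intro x hx
    set S : Finset (TorusSite d (2 * k)) := B ∪ {x, x + Pi.single i 1} with hS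
    have hYsupp : IsSupportedOn (c x * T - T * c x) S :=
      isSupportedOn_comm (isSupportedOn_dressedCurrent x i (by simp [hS]) (by simp [hS]))
        (IsSupportedOn.mono_holds hTsupp (Finset.subset_union_left))
    have hn := norm_dimerGen_comm_le hk i p hYsupp
    have hYn : ‖c x * T - T * c x‖ ≤ 1 / 4 := by
      refine (norm_comm_le _ _).trans ?_
      have ha := norm_dressedCurrent_le x i
      have hb := norm_bondHopping_le z (z + Pi.single j 1)
      have ha0 := norm_nonneg (c x)
      have hb0 := norm_nonneg T
      nlinarith
    have hcard : (S.card : ℝ) ≤ 3 := by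
      rw [Finset.mem_filter] at hx
      obtain ⟨-, -, htouch⟩ := hx
      have hne : (B ∩ {x, x + Pi.single i 1}).Nonempty := by
        rcases htouch with h | h
        · exact ⟨x, Finset.mem_inter.2 ⟨h, by simp⟩⟩
        · exact ⟨x + Pi.single i 1, Finset.mem_inter.2 ⟨h, by simp⟩⟩
      have hu := Finset.card_union_add_card_inter B ({x, x + Pi.single i 1} : Finset (TorusSite d (2 * k)))
      have hBc : B.card ≤ 2 := Finset.card_le_two
      have hDc : ({x, x + Pi.single i 1} : Finset (TorusSite d (2 * k))).card ≤ 2 := Finset.card_le_two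
      have hIc : 1 ≤ (B ∩ {x, x + Pi.single i 1}).card := Finset.card_pos.2 hne
      have : S.card ≤ 3 := by rw [hS]; omega
      exact_mod_cast this
    have h0 := norm_nonneg (c x * T - T * c x)
    nlinarith
  refine (Finset.sum_le_sum hterm).trans ?_
  rw [Finset.sum_const, nsmul_eq_mul]
  have hF2 : (F.card : ℝ) ≤ 2 := by
    have h := card_filter_touch_le hk i p B
    have hBc : B.card ≤ 2 := Finset.card_le_two
    exact_mod_cast h.trans hBc
  nlinarith

/-- `H_XY = -Σ_x Σᵢ t_{x,x+eᵢ}` on the torus of side `≥ 3` (each bond once).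
[cite: AizenmanEtAl2004, §2 (2.1)] -/
private theorem xyTorus_eq_neg_sum_hop (L : ℕ) [NeZero L] (hL : 3 ≤ L) :
    xyTorus d L 1 = -∑ x : TorusSite d L, ∑ i : Fin d,
      (siteSpin 1 x 0 * siteSpin 1 (x + Pi.single i 1) 0 + siteSpin 1 x 1 * siteSpin 1 (x + Pi.single i 1) 1 :
        Op (TorusSite d L) 2) := by
  have hne : ∀ (x : TorusSite d L) (i : Fin d), x ≠ x + Pi.single i 1 := fun x i h =>
    single_ne_zero_of_two_le L (by omega) i (by simpa using h.symm)
  rw [xyTorus_eq_bondSum, ← sum_pairs_eq_sum_edgeFinset' L hL, ← Finset.sum_neg_distrib]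
  refine Finset.sum_congr rfl fun x _ => ?_
  rw [← Finset.sum_neg_distrib]
  refine Finset.sum_congr rfl fun i _ => ?_
  rw [Sym2.lift_mk]
  dsimp only
  rw [spinBond_eq_mul_of_ne (hne x i) 0, spinBond_eq_mul_of_ne (hne x i) 1]
  simp only [Complex.ofReal_neg, Complex.ofReal_one, neg_smul, one_smul, Complex.ofReal_zero, zero_smul, add_zero,
    neg_add]

/-- **`K_H`**: `‖[C_{i,p}, [C_{i,p}, H_XY]]‖ ≤ ¾ d (2k)^d`. [cite: AizenmanEtAl2004, §4 proof of Theorem 3] -/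
private theorem norm_dimerGen_dcomm_xyTorus_le {k : ℕ} [NeZero (2 * k)] (hk : 2 ≤ k) (i : Fin d) (p : ℕ) :
    let C : Op (TorusSite d (2 * k)) 2 := ∑ x : TorusSite d (2 * k), if (x i).val % 2 = p then
        (((-1 : ℝ) ^ (∑ j, (x j).val) / 2 : ℝ) : ℂ) •
          (siteSpin 1 x 0 * siteSpin 1 (x + Pi.single i 1) 1 - siteSpin 1 x 1 * siteSpin 1 (x + Pi.single i 1) 0 :
            Op (TorusSite d (2 * k)) 2) else 0
    ‖C * (C * xyTorus d (2 * k) 1 - xyTorus d (2 * k) 1 * C) - (C * xyTorus d (2 * k) 1 - xyTorus d (2 * k) 1 * C) * C‖ ≤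
      3 / 4 * d * ((2 * k : ℕ) : ℝ) ^ d := by
  classical
  intro C
  set T : TorusSite d (2 * k) → Fin d → Op (TorusSite d (2 * k)) 2 := fun z j =>
    siteSpin 1 z 0 * siteSpin 1 (z + Pi.single j 1) 0 + siteSpin 1 z 1 * siteSpin 1 (z + Pi.single j 1) 1 with hT
  have hH : xyTorus d (2 * k) 1 = -∑ z, ∑ j, T z j := xyTorus_eq_neg_sum_hop (2 * k) (by omega)
  have hexp : C * (C * xyTorus d (2 * k) 1 - xyTorus d (2 * k) 1 * C) - (C * xyTorus d (2 * k) 1 - xyTorus d (2 * k) 1 * C) * C =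
      -∑ z, ∑ j, (C * (C * T z j - T z j * C) - (C * T z j - T z j * C) * C) := by
    rw [hH]
    simp only [Matrix.mul_neg, Matrix.neg_mul, Finset.mul_sum, Finset.sum_mul, Matrix.mul_sub, Matrix.sub_mul,
      Finset.sum_sub_distrib, neg_sub_neg]
    abel
  rw [hexp, norm_neg]
  refine (norm_sum_le _ _).trans ?_
  have hz : ∀ z ∈ (Finset.univ : Finset (TorusSite d (2 * k))),
      ‖∑ j, (C * (C * T z j - T z j * C) - (C * T z j - T z j * C) * C)‖ ≤ 3 / 4 * d := by
    intro z _
    refine (norm_sum_le _ _).trans ?_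
    have hj : ∀ j ∈ (Finset.univ : Finset (Fin d)), ‖C * (C * T z j - T z j * C) - (C * T z j - T z j * C) * C‖ ≤ 3 / 4 :=
      fun j _ => norm_dimerGen_dcomm_hop_le (by omega) i p z j
    refine (Finset.sum_le_sum hj).trans ?_
    rw [Finset.sum_const, Finset.card_univ, Fintype.card_fin, nsmul_eq_mul]
    linarith
  refine (Finset.sum_le_sum hz).trans ?_
  rw [Finset.sum_const, Finset.card_univ, nsmul_eq_mul]
  have hcard : (Fintype.card (TorusSite d (2 * k)) : ℝ) = ((2 * k : ℕ) : ℝ) ^ d := by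
    rw [Fintype.card_pi, Finset.prod_const, ZMod.card, Finset.card_univ, Fintype.card_fin]
    push_cast
    ring
  rw [hcard]
  nlinarith [pow_nonneg (show (0 : ℝ) ≤ ((2 * k : ℕ) : ℝ) by positivity) d]

end Torus

/-! ### §6 The variational bound `E(λ) ≤ E(0) + ½λ|Λ| - λ²e₀²|Λ|/(2d²(3d+λ))` (the source's (enes)) -/

section Assembly

variable {d : ℕ}

/-- `Σ_{p<2} [m ≡ p (2)] f = f`. [folklore] -/
private theorem sum_range_two_ite {α : Type*} [AddCommMonoid α] (m : ℕ) (f : α) :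
    ∑ p ∈ Finset.range 2, (if m % 2 = p then f else 0) = f := by
  rw [Finset.sum_ite_eq, if_pos (Finset.mem_range.2 (Nat.mod_lt m two_pos))]

/-- `|Λ| = (2k)^d` (real form). [folklore] -/
private theorem card_torusSite_real (k : ℕ) [NeZero (2 * k)] :
    (Fintype.card (TorusSite d (2 * k)) : ℝ) = ((2 * k : ℕ) : ℝ) ^ d := by
  rw [Fintype.card_pi, Finset.prod_const, ZMod.card, Finset.card_univ, Fintype.card_fin]
  push_cast
  ring

/-- The core of the source's (enes), for an abstract reference state: if `φ` is a positive normalised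
functional, stationary for `H_XY` (`φ(X H_XY) = φ(H_XY X)`) and with zero `3`-magnetisation
(`φ(S³_z) = 0`), and `B` is a lower bound for `Re φ(e^{iεC} H(λ) e^{-iεC})` over all Hermitian `C` and
real `ε`, then `B ≤ Re φ(H_XY) + ½λ|Λ| - λ² (Re φ(H_XY))² / (2d²(3d+λ)|Λ|)` (`d ≥ 1`, `λ ≥ 0`, torus
`(ℤ/2kℤ)^d`, `k ≥ 2`). With `φ` the ground state of `H_XY` and `B = E(λ)` this is (enes); with the Gibbs
state and Peierls–Bogoliubov it is the positive-temperature version. [cite: AizenmanEtAl2004, §4 Theorem 3 (enes)] -/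
theorem stagPerturb_core {k : ℕ} [NeZero (2 * k)] (hk : 2 ≤ k) (hd : 1 ≤ d) {lam : ℝ} (hlam : 0 ≤ lam)
    (φ : Op (TorusSite d (2 * k)) 2 →ₗ[ℂ] ℂ)
    (hP : ∀ X : Op (TorusSite d (2 * k)) 2, X.PosSemidef → 0 ≤ (φ X).re) (hN1 : φ 1 = 1)
    (hφcomm' : ∀ X : Op (TorusSite d (2 * k)) 2, φ (X * xyTorus d (2 * k) 1) = φ (xyTorus d (2 * k) 1 * X))
    (hφS : ∀ z : TorusSite d (2 * k), φ (siteSpin 1 z 2) = 0) {B : ℝ}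
    (hB : ∀ Cm : Op (TorusSite d (2 * k)) 2, Cm.IsHermitian → ∀ ε : ℝ,
      B ≤ (φ (exp (ε • (I • Cm)) * hardCoreLatticeGas d (2 * k) lam * (exp (ε • (I • Cm)))ᴴ)).re) :
    B ≤ (φ (xyTorus d (2 * k) 1)).re + lam * ((2 * k : ℕ) : ℝ) ^ d / 2 -
        lam ^ 2 * (φ (xyTorus d (2 * k) 1)).re ^ 2 / (2 * (d : ℝ) ^ 2 * (3 * d + lam) * ((2 * k : ℕ) : ℝ) ^ d) := by
  classical
  have hk1 : 1 ≤ k := by omega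
  have hL3 : 3 ≤ 2 * k := by omega
  set N : ℝ := ((2 * k : ℕ) : ℝ) ^ d with hN
  have hNpos : 0 < N := by positivity
  have hcardN : (Fintype.card (TorusSite d (2 * k)) : ℝ) = N := card_torusSite_real k
  set H₀ : Op (TorusSite d (2 * k)) 2 := xyTorus d (2 * k) 1 with hH₀
  set E₀ : ℝ := (φ H₀).re with hE₀
  have hH₀h : H₀.IsHermitian := xyTorus_isHermitian d (2 * k) 1
  set Hl : Op (TorusSite d (2 * k)) 2 := hardCoreLatticeGas d (2 * k) lam with hHl
  set W : Op (TorusSite d (2 * k)) 2 := ∑ z : TorusSite d (2 * k), ((1 / 2 : ℂ) • (1 : Op (TorusSite d (2 * k)) 2) +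
    (((-1 : ℝ) ^ (∑ j, (z j).val) : ℝ) : ℂ) • siteSpin 1 z 2) with hW
  have hHlW : Hl = H₀ + (lam : ℂ) • W := hardCoreLatticeGas_eq_real (2 * k) lam
  have hWh : W.IsHermitian := by
    rw [hW, IsHermitian, conjTranspose_sum]
    refine Finset.sum_congr rfl fun z _ => ?_
    rw [conjTranspose_add, conjTranspose_smul, conjTranspose_smul, conjTranspose_one, (siteSpin_isHermitian 1 z 2).eq]
    simp only [map_div₀, map_one, map_ofNat, Complex.conj_ofReal, Complex.star_def]
  set C : Fin d → ℕ → Op (TorusSite d (2 * k)) 2 := fun i p => ∑ x : TorusSite d (2 * k), if (x i).val % 2 = p then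
      (((-1 : ℝ) ^ (∑ j, (x j).val) / 2 : ℝ) : ℂ) •
        (siteSpin 1 x 0 * siteSpin 1 (x + Pi.single i 1) 1 - siteSpin 1 x 1 * siteSpin 1 (x + Pi.single i 1) 0 :
          Op (TorusSite d (2 * k)) 2) else 0 with hC
  set T : Fin d → ℕ → Op (TorusSite d (2 * k)) 2 := fun i p => ∑ x : TorusSite d (2 * k), if (x i).val % 2 = p then
      (siteSpin 1 x 0 * siteSpin 1 (x + Pi.single i 1) 0 + siteSpin 1 x 1 * siteSpin 1 (x + Pi.single i 1) 1 :
        Op (TorusSite d (2 * k)) 2) else 0 with hT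
  set cnt : Fin d → ℕ → ℝ := fun i p => ∑ x : TorusSite d (2 * k), if (x i).val % 2 = p then (1 : ℝ) else 0 with hcnt
  -- the reference state
  have hφH : (φ H₀).re = E₀ := rfl
  have hφcomm : ∀ X : Op (TorusSite d (2 * k)) 2, φ (I • (X * H₀ - H₀ * X)) = 0 := by
    intro X
    rw [map_smul, map_sub, hφcomm' X, sub_self, smul_zero]
  have hφW : (φ W).re = N / 2 := by
    rw [hW, map_sum]
    simp only [map_add, map_smul, hN1, hφS, smul_eq_mul, mul_one, mul_zero, add_zero]
    rw [Finset.sum_const, Finset.card_univ, nsmul_eq_mul, Complex.mul_re]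
    simp only [Complex.natCast_re, Complex.natCast_im, zero_mul, sub_zero]
    rw [hcardN]
    norm_num
    ring
  -- one covering `(i, p)`, one `ε`
  have hstep : ∀ (i : Fin d) (p : ℕ) (ε : ℝ), B ≤
      E₀ + (3 / 4 * d * N) * ε ^ 2 / 2 + lam * (N / 2 + ε * (φ (T i p)).re + (cnt i p / 2) * ε ^ 2 / 2) := by
    intro i p ε
    have hCh : (C i p).IsHermitian := dimerGen_isHermitian hk1 i p
    have hUct : (exp (ε • (I • C i p)))ᴴ = exp (ε • -(I • C i p)) := exp_smul_I_conjTranspose hCh ε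
    have hvar : B ≤ (φ (exp (ε • (I • C i p)) * Hl * (exp (ε • (I • C i p)))ᴴ)).re := hB (C i p) hCh ε
    have hsplit : (φ (exp (ε • (I • C i p)) * Hl * (exp (ε • (I • C i p)))ᴴ)).re =
        (φ (exp (ε • (I • C i p)) * H₀ * exp (ε • -(I • C i p)))).re +
          lam * (φ (exp (ε • (I • C i p)) * W * exp (ε • -(I • C i p)))).re := by
      rw [hUct, hHlW, Matrix.mul_add, Matrix.add_mul, Matrix.mul_smul, Matrix.smul_mul, map_add, map_smul,
        Complex.add_re, smul_eq_mul, Complex.re_ofReal_mul]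
    have hKH : ‖C i p * (C i p * H₀ - H₀ * C i p) - (C i p * H₀ - H₀ * C i p) * C i p‖ ≤ 3 / 4 * d * N :=
      norm_dimerGen_dcomm_xyTorus_le hk i p
    have hKW : ‖C i p * (C i p * W - W * C i p) - (C i p * W - W * C i p) * C i p‖ ≤ cnt i p / 2 :=
      norm_dimerGen_dcomm_stagPotential_le hk1 i p
    have hTH := re_state_conj_exp_le_taylor φ hP hN1 hCh hH₀h hKH ε
    have hTW := re_state_conj_exp_le_taylor φ hP hN1 hCh hWh hKW ε
    have hfirstW : φ (I • (C i p * W - W * C i p)) = φ (T i p) := by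
      have h := dimerGen_comm_stagPotential hk1 i p
      rw [h, smul_neg, smul_smul, I_mul_I, neg_smul, one_smul, neg_neg]
    rw [hφcomm (C i p), Complex.zero_re, mul_zero, add_zero, hφH] at hTH
    rw [hfirstW, hφW] at hTW
    calc B ≤ _ := hvar
      _ = _ := hsplit
      _ ≤ (E₀ + 3 / 4 * d * N * ε ^ 2 / 2) + lam * (N / 2 + ε * (φ (T i p)).re + cnt i p / 2 * ε ^ 2 / 2) :=
          add_le_add hTH (mul_le_mul_of_nonneg_left hTW hlam)
  -- summing the `2d` coverings
  have hsumT : ∑ i : Fin d, ∑ p ∈ Finset.range 2, (φ (T i p)).re = -E₀ := by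
    have h1 : ∀ i : Fin d, ∑ p ∈ Finset.range 2, T i p = ∑ x : TorusSite d (2 * k),
        (siteSpin 1 x 0 * siteSpin 1 (x + Pi.single i 1) 0 + siteSpin 1 x 1 * siteSpin 1 (x + Pi.single i 1) 1 :
          Op (TorusSite d (2 * k)) 2) := by
      intro i
      rw [hT]
      dsimp only
      rw [Finset.sum_comm]
      exact Finset.sum_congr rfl fun x _ => sum_range_two_ite _ _
    have h2 : ∑ i : Fin d, ∑ p ∈ Finset.range 2, T i p = -H₀ := by
      rw [Finset.sum_congr rfl fun i _ => h1 i, Finset.sum_comm, hH₀, xyTorus_eq_neg_sum_hop (2 * k) hL3, neg_neg]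
    have h3 : ∑ i : Fin d, ∑ p ∈ Finset.range 2, (φ (T i p)).re = (φ (∑ i : Fin d, ∑ p ∈ Finset.range 2, T i p)).re := by
      rw [map_sum, Complex.re_sum]
      refine Finset.sum_congr rfl fun i _ => ?_
      rw [map_sum, Complex.re_sum]
    rw [h3, h2, map_neg, Complex.neg_re, hφH]
  have hsumcnt : ∑ i : Fin d, ∑ p ∈ Finset.range 2, cnt i p = d * N := by
    have h1 : ∀ i : Fin d, ∑ p ∈ Finset.range 2, cnt i p = N := by
      intro i
      rw [hcnt]
      dsimp only
      rw [Finset.sum_comm]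
      rw [Finset.sum_congr rfl fun x _ => sum_range_two_ite ((x i).val) (1 : ℝ), Finset.sum_const, Finset.card_univ,
        nsmul_eq_mul, mul_one, hcardN]
    rw [Finset.sum_congr rfl fun i _ => h1 i, Finset.sum_const, Finset.card_univ, Fintype.card_fin, nsmul_eq_mul]
  have key : ∀ ε : ℝ, (2 * d : ℝ) * B ≤
      2 * d * E₀ + d * lam * N - lam * ε * E₀ + (d * N / 4) * (3 * d + lam) * ε ^ 2 := by
    intro ε
    have h := Finset.sum_le_sum fun i (_ : i ∈ (Finset.univ : Finset (Fin d))) =>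
      Finset.sum_le_sum fun p (_ : p ∈ Finset.range 2) => hstep i p ε
    have hl : ∑ i ∈ (Finset.univ : Finset (Fin d)), ∑ p ∈ Finset.range 2, B = 2 * d * B := by
      simp only [Finset.sum_const, Finset.card_range, Finset.card_univ, Fintype.card_fin, nsmul_eq_mul, Nat.cast_ofNat]
      ring
    have hr : ∑ i ∈ (Finset.univ : Finset (Fin d)), ∑ p ∈ Finset.range 2,
        (E₀ + (3 / 4 * d * N) * ε ^ 2 / 2 + lam * (N / 2 + ε * (φ (T i p)).re + (cnt i p / 2) * ε ^ 2 / 2)) =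
        2 * d * (E₀ + (3 / 4 * d * N) * ε ^ 2 / 2 + lam * N / 2) + lam * ε * (∑ i : Fin d, ∑ p ∈ Finset.range 2, (φ (T i p)).re) +
          lam * ε ^ 2 / 4 * (∑ i : Fin d, ∑ p ∈ Finset.range 2, cnt i p) := by
      have e : ∀ (i : Fin d) (p : ℕ), E₀ + (3 / 4 * d * N) * ε ^ 2 / 2 + lam * (N / 2 + ε * (φ (T i p)).re + (cnt i p / 2) * ε ^ 2 / 2) =
          (E₀ + (3 / 4 * d * N) * ε ^ 2 / 2 + lam * N / 2) + (lam * ε * (φ (T i p)).re + lam * ε ^ 2 / 4 * cnt i p) := by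
        intro i p; ring
      simp only [e, Finset.sum_add_distrib, Finset.sum_const, Finset.card_range, Finset.card_univ, Fintype.card_fin,
        nsmul_eq_mul, ← Finset.mul_sum, Nat.cast_ofNat]
      ring
    rw [hl, hr, hsumT, hsumcnt] at h
    nlinarith [h]
  -- the optimal `ε`
  have hdpos : (0 : ℝ) < d := by exact_mod_cast hd
  have hQpos : 0 < (d : ℝ) * N * (3 * d + lam) := by positivity
  set ε₀ : ℝ := 2 * lam * E₀ / (d * N * (3 * d + lam)) with hε₀
  have hk' := key ε₀
  have hval : -lam * ε₀ * E₀ + (d * N / 4) * (3 * d + lam) * ε₀ ^ 2 = -(lam ^ 2 * E₀ ^ 2 / (d * N * (3 * d + lam))) := by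
    rw [hε₀]
    field_simp
    ring
  have h2d : (0 : ℝ) < 2 * d := by positivity
  rw [show B = (2 * d * B) / (2 * d) by field_simp]
  rw [div_le_iff₀ h2d]
  have hrhs : ((E₀ + lam * N / 2 - lam ^ 2 * E₀ ^ 2 / (2 * (d : ℝ) ^ 2 * (3 * d + lam) * N))) * (2 * d) =
      2 * d * E₀ + d * lam * N - lam ^ 2 * E₀ ^ 2 / (d * N * (3 * d + lam)) := by
    field_simp
  rw [hrhs]
  linarith [hk', hval]

/-- **ALSSY (enes): the staggered potential lowers the energy at second order.** For the hard-core
lattice gas `H(λ) = H_XY + λW` on the even torus `(ℤ/2kℤ)^d` (`k ≥ 2`, `d ≥ 1`, `λ ≥ 0`), with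
`E(λ)` its ground-state energy and `e₀ = E(0)/|Λ|`,
`E(λ) ≤ E(0) + ½λ|Λ| - λ² e₀² |Λ| / (2d²(3d + λ))`.
Proof as printed: the unitary `e^{iεC}` generated by the bond currents (`[C, W] = iH₀`) applied to the
ground state of `H_XY`, Taylor's formula to second order with the double-commutator norms, and the
optimal `ε`; here `C` runs over the `2d` dimer coverings `{x, x+eᵢ}_{x_i ≡ p}` and the resulting bounds
are averaged, which reproduces the printed constant. [cite: AizenmanEtAl2004, §4 Theorem 3 (enes)]
[cite: LSSY2005, Ch. 11 Theorem 11.4 (11.44)] -/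
theorem hardCoreLatticeGas_groundEnergy_le_stagPerturb {k : ℕ} [NeZero (2 * k)] (hk : 2 ≤ k) (hd : 1 ≤ d)
    {lam : ℝ} (hlam : 0 ≤ lam) :
    (hardCoreLatticeGas d (2 * k) lam).groundEnergy ≤
      (xyTorus d (2 * k) 1).groundEnergy + lam * ((2 * k : ℕ) : ℝ) ^ d / 2 -
        lam ^ 2 * (xyTorus d (2 * k) 1).groundEnergy ^ 2 /
          (2 * (d : ℝ) ^ 2 * (3 * d + lam) * ((2 * k : ℕ) : ℝ) ^ d) := by
  have hL3 : 3 ≤ 2 * k := by omega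
  have hH₀h : (xyTorus d (2 * k) 1).IsHermitian := xyTorus_isHermitian d (2 * k) 1
  have hHlh : (hardCoreLatticeGas d (2 * k) lam).IsHermitian := hardCoreLatticeGas_isHermitian d (2 * k) lam
  set φ := (xyTorus d (2 * k) 1).groundStateFunctional with hφ
  have hP : ∀ X : Op (TorusSite d (2 * k)) 2, X.PosSemidef → 0 ≤ (φ X).re := fun X hX =>
    (Complex.nonneg_iff.mp (groundStateFunctional_nonneg_of_posSemidef _ hX)).1
  have hN1 : φ 1 = 1 := groundStateFunctional_one hH₀h
  have hcomm : ∀ X : Op (TorusSite d (2 * k)) 2, φ (X * xyTorus d (2 * k) 1) = φ (xyTorus d (2 * k) 1 * X) := by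
    intro X
    rw [hφ, groundStateFunctional_mul_hamiltonian, groundStateFunctional_hamiltonian_mul hH₀h]
  have hS : ∀ z : TorusSite d (2 * k), φ (siteSpin 1 z 2) = 0 := by
    intro z
    rw [hφ, ← HardCoreBoson.hamiltonian_one_eq_xyTorus hL3]
    exact HardCoreBoson.groundState_spinThree_eq_zero (by omega) _ z
  have hB : ∀ Cm : Op (TorusSite d (2 * k)) 2, Cm.IsHermitian → ∀ ε : ℝ,
      (hardCoreLatticeGas d (2 * k) lam).groundEnergy ≤
        (φ (exp (ε • (I • Cm)) * hardCoreLatticeGas d (2 * k) lam * (exp (ε • (I • Cm)))ᴴ)).re :=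
    fun Cm hCm ε => groundEnergy_le_re_state_conj φ hP hN1
      (by rw [exp_smul_I_conjTranspose hCm ε]; exact exp_smul_I_mul_exp_neg Cm ε) hHlh
  have h := stagPerturb_core hk hd hlam φ hP hN1 hcomm hS hB
  have hφH : (φ (xyTorus d (2 * k) 1)).re = (xyTorus d (2 * k) 1).groundEnergy := by
    rw [hφ, groundStateFunctional_hamiltonian hH₀h, Complex.ofReal_re]
  rw [hφH] at h
  exact h

end Assembly

/-! ### §7 Theorem 3 (ground state): the staggered potential induces a staggered density, linearly in `λ` -/

section StaggeredDensity

variable {d : ℕ}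

/-- `Σ_x (-1)^x = 0` on the even torus (`d ≥ 1`). [cite: LSSY2005, Ch. 11 (11.2)] -/
private theorem sum_stag_eq_zero {k : ℕ} [NeZero (2 * k)] (hd : 1 ≤ d) :
    ∑ x : TorusSite d (2 * k), (-1 : ℝ) ^ (∑ j, (x j).val) = 0 := by
  set i₀ : Fin d := ⟨0, hd⟩
  have h : ∑ x : TorusSite d (2 * k), (-1 : ℝ) ^ (∑ j, (x j).val) =
      ∑ x : TorusSite d (2 * k), (-1 : ℝ) ^ (∑ j, ((x + Pi.single i₀ 1 : TorusSite d (2 * k)) j).val) :=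
    (Fintype.sum_equiv (Equiv.addRight (Pi.single i₀ (1 : ZMod (2 * k))))
      (fun x : TorusSite d (2 * k) => (-1 : ℝ) ^ (∑ j, ((x + Pi.single i₀ 1 : TorusSite d (2 * k)) j).val))
      (fun x : TorusSite d (2 * k) => (-1 : ℝ) ^ (∑ j, (x j).val)) fun x => rfl).symm
  rw [Finset.sum_congr rfl fun x _ => stag_add_single x i₀, Finset.sum_neg_distrib] at h
  linarith

/-- **ALSSY Theorem 3 (ground state), for every ground state.** Hard-core lattice bosons at half filling
in the staggered potential `λW`, `λ > 0`, on the even torus `(ℤ/2kℤ)^d` (`k ≥ 2`, `d ≥ 1`): in every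
state `φ` (positive, normalised) of ground-state energy, `φ(H(λ)) = E(λ)`, the staggered magnetisation
per site is bounded away from zero, linearly in `λ` and uniformly in the volume:
`|Λ|⁻¹ Σ_x (-1)^x φ(S³_x) ≤ -λ e₀² / (2d²(3d + λ))`, `e₀ = E(0)/|Λ|` the ground-state energy per site
of `H_XY` — the density `ϱ(x) = ½ + φ(S³_x)` is lower on the sublattice where the potential is higher.
(The printed statement is for the Gibbs state at `β ≤ ∞`; this is its `β = ∞` case, from (enes) and the
variational principle `λ φ(W) ≤ E(λ) - E(0)`.) [cite: AizenmanEtAl2004, §4 Theorem 3 (densstag)]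
[cite: LSSY2005, Ch. 11 Theorem 11.4 (11.45)] -/
theorem hardCoreLatticeGas_staggeredMagnetisation_le {k : ℕ} [NeZero (2 * k)] (hk : 2 ≤ k) (hd : 1 ≤ d)
    {lam : ℝ} (hlam : 0 < lam) (φ : Op (TorusSite d (2 * k)) 2 →ₗ[ℂ] ℂ)
    (hP : ∀ X : Op (TorusSite d (2 * k)) 2, X.PosSemidef → 0 ≤ (φ X).re) (hN : φ 1 = 1)
    (hGS : (φ (hardCoreLatticeGas d (2 * k) lam)).re ≤ (hardCoreLatticeGas d (2 * k) lam).groundEnergy) :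
    (∑ x : TorusSite d (2 * k), (-1 : ℝ) ^ (∑ j, (x j).val) * (φ (siteSpin 1 x 2)).re) / ((2 * k : ℕ) : ℝ) ^ d ≤
      -(lam * ((xyTorus d (2 * k) 1).groundEnergy / ((2 * k : ℕ) : ℝ) ^ d) ^ 2 / (2 * (d : ℝ) ^ 2 * (3 * d + lam))) := by
  classical
  set N : ℝ := ((2 * k : ℕ) : ℝ) ^ d with hNdef
  have hNpos : 0 < N := by positivity
  have hcardN : (Fintype.card (TorusSite d (2 * k)) : ℝ) = N := card_torusSite_real k
  set H₀ : Op (TorusSite d (2 * k)) 2 := xyTorus d (2 * k) 1 with hH₀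
  set E₀ : ℝ := H₀.groundEnergy with hE₀
  have hH₀h : H₀.IsHermitian := xyTorus_isHermitian d (2 * k) 1
  set W : Op (TorusSite d (2 * k)) 2 := ∑ z : TorusSite d (2 * k), ((1 / 2 : ℂ) • (1 : Op (TorusSite d (2 * k)) 2) +
    (((-1 : ℝ) ^ (∑ j, (z j).val) : ℝ) : ℂ) • siteSpin 1 z 2) with hW
  have hHlW : hardCoreLatticeGas d (2 * k) lam = H₀ + (lam : ℂ) • W := hardCoreLatticeGas_eq_real (2 * k) lam
  -- the variational principle for `H₀` in the state `φ`: `E(0) ≤ Re φ(H₀)`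
  have hvar : E₀ ≤ (φ H₀).re := by
    have h := groundEnergy_le_re_state_conj φ hP hN (U := 1) (by rw [conjTranspose_one, Matrix.mul_one]) hH₀h
    rwa [conjTranspose_one, Matrix.one_mul, Matrix.mul_one] at h
  -- `Re φ(W) = |Λ|/2 + Σ_x (-1)^x Re φ(S³_x)`
  have hφW : (φ W).re = N / 2 + ∑ x : TorusSite d (2 * k), (-1 : ℝ) ^ (∑ j, (x j).val) * (φ (siteSpin 1 x 2)).re := by
    rw [hW, map_sum, Complex.re_sum]
    simp only [map_add, map_smul, hN, smul_eq_mul, mul_one, Complex.add_re, Complex.re_ofReal_mul]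
    rw [Finset.sum_add_distrib, Finset.sum_const, Finset.card_univ, nsmul_eq_mul, hcardN]
    norm_num
    ring
  -- `λ Re φ(W) = Re φ(H(λ)) - Re φ(H₀) ≤ E(λ) - E(0) ≤ λ|Λ|/2 - λ² e₀²|Λ|/(2d²(3d+λ))`
  have hsplit : (φ (hardCoreLatticeGas d (2 * k) lam)).re = (φ H₀).re + lam * (φ W).re := by
    rw [hHlW, map_add, map_smul, Complex.add_re, smul_eq_mul, Complex.re_ofReal_mul]
  have henes := hardCoreLatticeGas_groundEnergy_le_stagPerturb hk hd hlam.le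
  have hchain : lam * (∑ x : TorusSite d (2 * k), (-1 : ℝ) ^ (∑ j, (x j).val) * (φ (siteSpin 1 x 2)).re) ≤
      -(lam ^ 2 * E₀ ^ 2 / (2 * (d : ℝ) ^ 2 * (3 * d + lam) * N)) := by
    have h1 : (φ H₀).re + lam * (φ W).re ≤ E₀ + lam * N / 2 - lam ^ 2 * E₀ ^ 2 / (2 * (d : ℝ) ^ 2 * (3 * d + lam) * N) := by
      rw [← hsplit]; exact hGS.trans henes
    rw [hφW] at h1
    nlinarith [h1, hvar]
  have hdpos : (0 : ℝ) < d := by exact_mod_cast hd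
  have hden : 0 < 2 * (d : ℝ) ^ 2 * (3 * d + lam) := by positivity
  rw [div_le_iff₀ hNpos]
  have hred : -(lam * (E₀ / N) ^ 2 / (2 * (d : ℝ) ^ 2 * (3 * d + lam))) * N =
      -(lam ^ 2 * E₀ ^ 2 / (2 * (d : ℝ) ^ 2 * (3 * d + lam) * N)) / lam := by
    field_simp
  rw [hred, le_div_iff₀ hlam, mul_comm]
  exact hchain

/-- **ALSSY Theorem 3 (ground state), tracial ground state.** The same bound for the tracial ground
state `ω` of `H(λ)`. [cite: AizenmanEtAl2004, §4 Theorem 3 (densstag)] [cite: LSSY2005, Ch. 11 Theorem 11.4 (11.45)] -/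
theorem hardCoreLatticeGas_groundState_staggeredMagnetisation_le {k : ℕ} [NeZero (2 * k)] (hk : 2 ≤ k) (hd : 1 ≤ d)
    {lam : ℝ} (hlam : 0 < lam) :
    (∑ x : TorusSite d (2 * k), (-1 : ℝ) ^ (∑ j, (x j).val) *
        ((hardCoreLatticeGas d (2 * k) lam).groundStateFunctional (siteSpin 1 x 2)).re) / ((2 * k : ℕ) : ℝ) ^ d ≤
      -(lam * ((xyTorus d (2 * k) 1).groundEnergy / ((2 * k : ℕ) : ℝ) ^ d) ^ 2 / (2 * (d : ℝ) ^ 2 * (3 * d + lam))) := by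
  have hH := hardCoreLatticeGas_isHermitian d (2 * k) lam
  refine hardCoreLatticeGas_staggeredMagnetisation_le hk hd hlam _ (fun X hX =>
    (Complex.nonneg_iff.mp (groundStateFunctional_nonneg_of_posSemidef _ hX)).1) (groundStateFunctional_one hH) ?_
  rw [groundStateFunctional_hamiltonian hH, Complex.ofReal_re]

/-- **ALSSY Theorem 3 (ground state), density form (densstag).** With `ϱ(x) = ω(n_x)` the density in
the tracial ground state of `H(λ)` (`n_x = a†_x a_x = S³_x + ½`, Matsubara–Matsuda), the staggered
density per site satisfies `|Λ|⁻¹ |Σ_x (-1)^x ϱ(x)| ≥ λ e₀²/(2d²(3d + λ))`: the density is NOT constant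
although (Theorem 1) the condensate wave function is. [cite: AizenmanEtAl2004, §4 Theorem 3 (densstag)]
[cite: LSSY2005, Ch. 11 Theorem 11.4 (11.45)] -/
theorem hardCoreLatticeGas_staggeredDensity_abs_ge {k : ℕ} [NeZero (2 * k)] (hk : 2 ≤ k) (hd : 1 ≤ d)
    {lam : ℝ} (hlam : 0 < lam) :
    lam * ((xyTorus d (2 * k) 1).groundEnergy / ((2 * k : ℕ) : ℝ) ^ d) ^ 2 / (2 * (d : ℝ) ^ 2 * (3 * d + lam)) ≤
      |(∑ x : TorusSite d (2 * k), (-1 : ℝ) ^ (∑ j, (x j).val) *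
          ((hardCoreLatticeGas d (2 * k) lam).groundStateFunctional (HardCoreBoson.num x)).re) / ((2 * k : ℕ) : ℝ) ^ d| := by
  have hH := hardCoreLatticeGas_isHermitian d (2 * k) lam
  have hnum : ∀ x : TorusSite d (2 * k),
      ((hardCoreLatticeGas d (2 * k) lam).groundStateFunctional (HardCoreBoson.num x)).re =
        ((hardCoreLatticeGas d (2 * k) lam).groundStateFunctional (siteSpin 1 x 2)).re + 1 / 2 := by
    intro x
    rw [HardCoreBoson.num_eq, map_add, map_smul, groundStateFunctional_one hH, Complex.add_re, smul_eq_mul, mul_one]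
    norm_num
  have hsum : ∑ x : TorusSite d (2 * k), (-1 : ℝ) ^ (∑ j, (x j).val) *
      ((hardCoreLatticeGas d (2 * k) lam).groundStateFunctional (HardCoreBoson.num x)).re =
      ∑ x : TorusSite d (2 * k), (-1 : ℝ) ^ (∑ j, (x j).val) *
        ((hardCoreLatticeGas d (2 * k) lam).groundStateFunctional (siteSpin 1 x 2)).re := by
    simp only [hnum, mul_add, Finset.sum_add_distrib, ← Finset.sum_mul, sum_stag_eq_zero hd, zero_mul, add_zero]
  rw [hsum]
  have h := hardCoreLatticeGas_groundState_staggeredMagnetisation_le hk hd hlam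
  have hnonneg : 0 ≤ lam * ((xyTorus d (2 * k) 1).groundEnergy / ((2 * k : ℕ) : ℝ) ^ d) ^ 2 / (2 * (d : ℝ) ^ 2 * (3 * d + lam)) := by
    positivity
  rw [le_abs]
  right
  linarith

end StaggeredDensity

/-! ### §8 Theorem 3 at positive temperature: the Gibbs state of `H_XY` as reference state and Peierls–Bogoliubov -/

section Thermal

variable {d : ℕ}

section GibbsCovariance

variable {m : Type*} [Fintype m] [DecidableEq m]

/-- Unitary covariance of Gibbs states: `⟨Wᴴ B W⟩_{β, Wᴴ X W} = ⟨B⟩_{β,X}`.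
[cite: BratteliRobinsonII1997, §5.3.1] -/
private theorem gibbsState_unitary_conj_stag (β : ℝ) {W : Matrix m m ℂ} (hWW : Wᴴ * W = 1) (hWW' : W * Wᴴ = 1)
    (X B : Matrix m m ℂ) : gibbsState β (Wᴴ * X * W) (Wᴴ * B * W) = gibbsState β X B := by
  have hU : IsUnit Wᴴ := ⟨⟨Wᴴ, W, hWW, hWW'⟩, rfl⟩
  have hinv : Wᴴ⁻¹ = W := Matrix.inv_eq_right_inv hWW
  have hexp : gibbsWeight β (Wᴴ * X * W) = Wᴴ * gibbsWeight β X * W := by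
    unfold gibbsWeight
    rw [show -(β : ℂ) • (Wᴴ * X * W) = Wᴴ * (-(β : ℂ) • X) * Wᴴ⁻¹ by
      rw [hinv, Matrix.mul_smul, Matrix.smul_mul], Matrix.exp_conj _ _ hU, hinv]
  have h1 : (Wᴴ * gibbsWeight β X * W).trace = (gibbsWeight β X).trace := by
    rw [Matrix.trace_mul_cycle, hWW', Matrix.one_mul]
  have h2 : (Wᴴ * gibbsWeight β X * W * (Wᴴ * B * W)).trace = (gibbsWeight β X * B).trace := by
    have e : Wᴴ * gibbsWeight β X * W * (Wᴴ * B * W) = Wᴴ * (gibbsWeight β X * B) * W := by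
      calc Wᴴ * gibbsWeight β X * W * (Wᴴ * B * W)
          = Wᴴ * gibbsWeight β X * (W * Wᴴ) * B * W := by simp only [Matrix.mul_assoc]
        _ = Wᴴ * (gibbsWeight β X * B) * W := by rw [hWW', Matrix.mul_one, Matrix.mul_assoc Wᴴ]
    rw [e, Matrix.trace_mul_cycle, hWW', Matrix.one_mul]
  rw [gibbsState_apply, gibbsState_apply, partitionFn, partitionFn, hexp, h1, h2]

/-- Unitary invariance of the partition function: `Z(Wᴴ X W) = Z(X)`. [cite: BratteliRobinsonII1997, §5.3.1] -/
private theorem partitionFn_unitary_conj_stag (β : ℝ) {W : Matrix m m ℂ} (hWW : Wᴴ * W = 1) (hWW' : W * Wᴴ = 1)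
    (X : Matrix m m ℂ) : partitionFn β (Wᴴ * X * W) = partitionFn β X := by
  have hU : IsUnit Wᴴ := ⟨⟨Wᴴ, W, hWW, hWW'⟩, rfl⟩
  have hinv : Wᴴ⁻¹ = W := Matrix.inv_eq_right_inv hWW
  have hexp : gibbsWeight β (Wᴴ * X * W) = Wᴴ * gibbsWeight β X * W := by
    unfold gibbsWeight
    rw [show -(β : ℂ) • (Wᴴ * X * W) = Wᴴ * (-(β : ℂ) • X) * Wᴴ⁻¹ by
      rw [hinv, Matrix.mul_smul, Matrix.smul_mul], Matrix.exp_conj _ _ hU, hinv]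
  rw [partitionFn, partitionFn, hexp, Matrix.trace_mul_cycle, hWW', Matrix.one_mul]

end GibbsCovariance

/-- Zero `3`-magnetisation of the Gibbs state of `H_XY` at every temperature (particle–hole symmetry
`a ↔ a†`, `n_x ↦ 1 - n_x`, of the hard-core Bose gas at half filling). [cite: AizenmanEtAl2004, §2] -/
theorem gibbsState_xyTorus_spinThree_eq_zero (β : ℝ) (L : ℕ) [NeZero L] (hL : 3 ≤ L) (z : TorusSite d L) :
    gibbsState β (xyTorus d L 1) (siteSpin 1 z 2) = 0 := by
  have hH : (xyTorus d L 1).IsHermitian := xyTorus_isHermitian d L 1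
  set F : Op (TorusSite d L) 2 := HardCoreBoson.flipOp with hF
  have hFF : F * Fᴴ = 1 := HardCoreBoson.flipOp_mul_conjTranspose
  have hFF' : Fᴴ * F = 1 := HardCoreBoson.flipOp_conjTranspose_mul
  have hcomm : F * xyTorus d L 1 = xyTorus d L 1 * F := by
    rw [← HardCoreBoson.hamiltonian_one_eq_xyTorus hL]
    exact HardCoreBoson.flipOp_mul_hamiltonian (by omega) _
  have hK : F * xyTorus d L 1 * Fᴴ = xyTorus d L 1 := by rw [hcomm, Matrix.mul_assoc, hFF, Matrix.mul_one]
  -- `⟨n_z⟩ = ⟨F n_z Fᴴ⟩ = ⟨1 - n_z⟩`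
  have hinv : gibbsState β (xyTorus d L 1) (F * HardCoreBoson.num z * Fᴴ) = gibbsState β (xyTorus d L 1) (HardCoreBoson.num z) := by
    have h := gibbsState_unitary_conj_stag β (W := Fᴴ) (by rw [conjTranspose_conjTranspose]; exact hFF)
      (by rw [conjTranspose_conjTranspose]; exact hFF') (xyTorus d L 1) (HardCoreBoson.num z)
    rw [conjTranspose_conjTranspose, hK] at h
    exact h
  rw [HardCoreBoson.flipOp_conj_num, map_sub, gibbsState_one β _ (partitionFn_pos β hH).ne'] at hinv
  have hnum : gibbsState β (xyTorus d L 1) (HardCoreBoson.num z) = 1 / 2 := by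
    linear_combination (-(1 / 2) : ℂ) * hinv
  rw [HardCoreBoson.num_eq, map_add, map_smul, gibbsState_one β _ (partitionFn_pos β hH).ne', smul_eq_mul, mul_one] at hnum
  linear_combination hnum

/-- **(enes) at positive temperature**: with `F_β(X) = -β⁻¹ log tr e^{-βX}` the free energy and
`e(0,β) = |Λ|⁻¹⟨H_XY⟩_{β,H_XY}` the thermal energy per site at `λ = 0`,
`F_β(H(λ)) ≤ F_β(H_XY) + ½λ|Λ| - λ² e(0,β)² |Λ| / (2d²(3d+λ))` (`β > 0`, `λ ≥ 0`, `d ≥ 1`, torus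
`(ℤ/2kℤ)^d`, `k ≥ 2`): the rotated Gibbs state of `H_XY` as a trial state in Peierls–Bogoliubov's
inequality, then the Taylor step as at `β = ∞` ("A similar argument works at positive temperature").
[cite: AizenmanEtAl2004, §4 Theorem 3 (enes)] [cite: LSSY2005, Ch. 11 Theorem 11.4] -/
theorem hardCoreLatticeGas_freeEnergy_le_stagPerturb {k : ℕ} [NeZero (2 * k)] (hk : 2 ≤ k) (hd : 1 ≤ d)
    {lam : ℝ} (hlam : 0 ≤ lam) {β : ℝ} (hβ : 0 < β) :
    -(1 / β) * Real.log (partitionFn β (hardCoreLatticeGas d (2 * k) lam)).re ≤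
      -(1 / β) * Real.log (partitionFn β (xyTorus d (2 * k) 1)).re + lam * ((2 * k : ℕ) : ℝ) ^ d / 2 -
        lam ^ 2 * (gibbsState β (xyTorus d (2 * k) 1) (xyTorus d (2 * k) 1)).re ^ 2 /
          (2 * (d : ℝ) ^ 2 * (3 * d + lam) * ((2 * k : ℕ) : ℝ) ^ d) := by
  have hL3 : 3 ≤ 2 * k := by omega
  set H₀ : Op (TorusSite d (2 * k)) 2 := xyTorus d (2 * k) 1 with hH₀
  set Hl : Op (TorusSite d (2 * k)) 2 := hardCoreLatticeGas d (2 * k) lam with hHl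
  have hH₀h : H₀.IsHermitian := xyTorus_isHermitian d (2 * k) 1
  have hHlh : Hl.IsHermitian := hardCoreLatticeGas_isHermitian d (2 * k) lam
  set φ := gibbsState β H₀ with hφ
  have hZ0 : partitionFn β H₀ ≠ 0 := (partitionFn_pos β hH₀h).ne'
  have hP : ∀ X : Op (TorusSite d (2 * k)) 2, X.PosSemidef → 0 ≤ (φ X).re := fun X hX =>
    (Complex.nonneg_iff.mp (gibbsState_nonneg_of_posSemidef β hH₀h hX)).1
  have hN1 : φ 1 = 1 := gibbsState_one β H₀ hZ0
  have hcomm : ∀ X : Op (TorusSite d (2 * k)) 2, φ (X * xyTorus d (2 * k) 1) = φ (xyTorus d (2 * k) 1 * X) :=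
    fun X => (gibbsState_hamiltonian_mul β H₀ X).symm
  have hS : ∀ z : TorusSite d (2 * k), φ (siteSpin 1 z 2) = 0 := fun z =>
    gibbsState_xyTorus_spinThree_eq_zero β (2 * k) hL3 z
  -- Peierls–Bogoliubov with the rotated reference Hamiltonian `K = Uᴴ H₀ U`
  set B : ℝ := -(1 / β) * Real.log (partitionFn β Hl).re - -(1 / β) * Real.log (partitionFn β H₀).re + (φ H₀).re
    with hBdef
  have hB : ∀ Cm : Op (TorusSite d (2 * k)) 2, Cm.IsHermitian → ∀ ε : ℝ,
      B ≤ (φ (exp (ε • (I • Cm)) * Hl * (exp (ε • (I • Cm)))ᴴ)).re := by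
    intro Cm hCm ε
    set U : Op (TorusSite d (2 * k)) 2 := exp (ε • (I • Cm)) with hU
    have hUct : Uᴴ = exp (ε • -(I • Cm)) := exp_smul_I_conjTranspose hCm ε
    have hUU' : U * Uᴴ = 1 := by rw [hUct]; exact exp_smul_I_mul_exp_neg Cm ε
    have hUU : Uᴴ * U = 1 := mul_eq_one_comm.1 hUU'
    set K : Op (TorusSite d (2 * k)) 2 := Uᴴ * H₀ * U with hK
    have hKh : K.IsHermitian := by
      rw [hK, IsHermitian, conjTranspose_mul, conjTranspose_mul, conjTranspose_conjTranspose, hH₀h.eq, Matrix.mul_assoc]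
    have hZK : partitionFn β K = partitionFn β H₀ := partitionFn_unitary_conj_stag β hUU hUU' H₀
    have hgK : ∀ Y : Op (TorusSite d (2 * k)) 2, gibbsState β K Y = φ (U * Y * Uᴴ) := by
      intro Y
      have h := gibbsState_unitary_conj_stag β hUU hUU' H₀ (U * Y * Uᴴ)
      rw [show Uᴴ * (U * Y * Uᴴ) * U = Y by
        rw [← Matrix.mul_assoc, ← Matrix.mul_assoc, hUU, Matrix.one_mul, Matrix.mul_assoc, hUU, Matrix.mul_one]] at h
      exact h
    have hKK : φ (U * K * Uᴴ) = φ H₀ := by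
      rw [hK, show U * (Uᴴ * H₀ * U) * Uᴴ = H₀ by
        rw [← Matrix.mul_assoc, ← Matrix.mul_assoc, hUU', Matrix.one_mul, Matrix.mul_assoc, hUU', Matrix.mul_one]]
    have hPB := log_partitionFn_sub_le_log_partitionFn_add hKh (hHlh.sub hKh) β
    rw [add_sub_cancel, hZK, map_sub, Complex.sub_re, hgK Hl, hgK K, hKK] at hPB
    -- `log Z(H₀) - β (Re φ(U Hl Uᴴ) - Re φ(H₀)) ≤ log Z(Hl)`
    rw [hBdef]
    have hβ' : 0 < 1 / β := by positivity
    have e1 : -(1 / β) * Real.log (partitionFn β Hl).re - -(1 / β) * Real.log (partitionFn β H₀).re =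
        (1 / β) * (Real.log (partitionFn β H₀).re - Real.log (partitionFn β Hl).re) := by ring
    rw [e1]
    have e2 : (1 / β) * (Real.log (partitionFn β H₀).re - Real.log (partitionFn β Hl).re) ≤
        (1 / β) * (β * ((φ (U * Hl * Uᴴ)).re - (φ H₀).re)) := mul_le_mul_of_nonneg_left (by linarith) hβ'.le
    have e3 : (1 / β) * (β * ((φ (U * Hl * Uᴴ)).re - (φ H₀).re)) = (φ (U * Hl * Uᴴ)).re - (φ H₀).re := by
      field_simp
    linarith
  have h := stagPerturb_core hk hd hlam φ hP hN1 hcomm hS hB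
  rw [hBdef] at h
  linarith

/-- **ALSSY Theorem 3 at positive temperature (as printed).** For the Gibbs state `⟨·⟩_{β,λ}` of the
hard-core lattice gas `H(λ)` (`λ > 0`, `β > 0`) on the even torus `(ℤ/2kℤ)^d` (`k ≥ 2`, `d ≥ 1`):
`|Λ|⁻¹ Σ_x (-1)^x ⟨S³_x⟩_{β,λ} ≤ -λ e(0,β)² / (2d²(3d + λ))`, `e(0,β) = |Λ|⁻¹⟨H_XY⟩_{β,λ=0}`; by
Peierls–Bogoliubov `λ⟨W⟩_{β,λ} ≤ F_β(λ) - F_β(0)` and the positive-temperature (enes).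
[cite: AizenmanEtAl2004, §4 Theorem 3 (densstag)] [cite: LSSY2005, Ch. 11 Theorem 11.4 (11.45)] -/
theorem hardCoreLatticeGas_thermal_staggeredMagnetisation_le {k : ℕ} [NeZero (2 * k)] (hk : 2 ≤ k) (hd : 1 ≤ d)
    {lam : ℝ} (hlam : 0 < lam) {β : ℝ} (hβ : 0 < β) :
    (∑ x : TorusSite d (2 * k), (-1 : ℝ) ^ (∑ j, (x j).val) *
        (gibbsState β (hardCoreLatticeGas d (2 * k) lam) (siteSpin 1 x 2)).re) / ((2 * k : ℕ) : ℝ) ^ d ≤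
      -(lam * ((gibbsState β (xyTorus d (2 * k) 1) (xyTorus d (2 * k) 1)).re / ((2 * k : ℕ) : ℝ) ^ d) ^ 2 /
        (2 * (d : ℝ) ^ 2 * (3 * d + lam))) := by
  classical
  set N : ℝ := ((2 * k : ℕ) : ℝ) ^ d with hNdef
  have hNpos : 0 < N := by positivity
  have hcardN : (Fintype.card (TorusSite d (2 * k)) : ℝ) = N := card_torusSite_real k
  set H₀ : Op (TorusSite d (2 * k)) 2 := xyTorus d (2 * k) 1 with hH₀
  set Hl : Op (TorusSite d (2 * k)) 2 := hardCoreLatticeGas d (2 * k) lam with hHl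
  have hH₀h : H₀.IsHermitian := xyTorus_isHermitian d (2 * k) 1
  have hHlh : Hl.IsHermitian := hardCoreLatticeGas_isHermitian d (2 * k) lam
  set E : ℝ := (gibbsState β H₀ H₀).re with hE
  set W : Op (TorusSite d (2 * k)) 2 := ∑ z : TorusSite d (2 * k), ((1 / 2 : ℂ) • (1 : Op (TorusSite d (2 * k)) 2) +
    (((-1 : ℝ) ^ (∑ j, (z j).val) : ℝ) : ℂ) • siteSpin 1 z 2) with hW
  have hHlW : Hl = H₀ + (lam : ℂ) • W := hardCoreLatticeGas_eq_real (2 * k) lam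
  have hZl : partitionFn β Hl ≠ 0 := (partitionFn_pos β hHlh).ne'
  -- `Re ⟨W⟩_λ = |Λ|/2 + Σ_x (-1)^x Re ⟨S³_x⟩_λ`
  have hφW : (gibbsState β Hl W).re = N / 2 + ∑ x : TorusSite d (2 * k), (-1 : ℝ) ^ (∑ j, (x j).val) *
      (gibbsState β Hl (siteSpin 1 x 2)).re := by
    rw [hW, map_sum, Complex.re_sum]
    simp only [map_add, map_smul, gibbsState_one β Hl hZl, smul_eq_mul, mul_one, Complex.add_re, Complex.re_ofReal_mul]
    rw [Finset.sum_add_distrib, Finset.sum_const, Finset.card_univ, nsmul_eq_mul, hcardN]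
    norm_num
    ring
  -- Peierls–Bogoliubov: `λ Re⟨W⟩_λ ≤ F(λ) - F(0)`
  have hPB := log_partitionFn_sub_le_log_partitionFn_add hHlh (hH₀h.sub hHlh) β
  have hdiff : H₀ - Hl = (-lam : ℂ) • W := by rw [hHlW]; simp [neg_smul]
  rw [add_sub_cancel, hdiff, map_smul, smul_eq_mul, show ((-lam : ℂ) * gibbsState β Hl W).re =
    -lam * (gibbsState β Hl W).re by rw [show (-lam : ℂ) = ((-lam : ℝ) : ℂ) by push_cast; ring, Complex.re_ofReal_mul]] at hPB
  -- `hPB : log Z(Hl) - β(-λ Re⟨W⟩) ≤ log Z(H₀)`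
  have henes := hardCoreLatticeGas_freeEnergy_le_stagPerturb hk hd hlam.le hβ
  -- combine: `β λ Re⟨W⟩_λ ≤ log Z(H₀) - log Z(Hl) ≤ β (λN/2 - λ² E²/(2d²(3d+λ)N))`
  have h1 : lam * (gibbsState β Hl W).re ≤ lam * N / 2 - lam ^ 2 * E ^ 2 / (2 * (d : ℝ) ^ 2 * (3 * d + lam) * N) := by
    have e1 : β * (lam * (gibbsState β Hl W).re) ≤ Real.log (partitionFn β H₀).re - Real.log (partitionFn β Hl).re := by
      linarith
    have e2 : Real.log (partitionFn β H₀).re - Real.log (partitionFn β Hl).re ≤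
        β * (lam * N / 2 - lam ^ 2 * E ^ 2 / (2 * (d : ℝ) ^ 2 * (3 * d + lam) * N)) := by
      have h := henes
      have e : β * (lam * N / 2 - lam ^ 2 * E ^ 2 / (2 * (d : ℝ) ^ 2 * (3 * d + lam) * N)) =
          β * ((-(1 / β) * Real.log (partitionFn β H₀).re + lam * N / 2 -
            lam ^ 2 * E ^ 2 / (2 * (d : ℝ) ^ 2 * (3 * d + lam) * N)) - -(1 / β) * Real.log (partitionFn β H₀).re) := by
        ring
      rw [e]
      have e' : Real.log (partitionFn β H₀).re - Real.log (partitionFn β Hl).re =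
          β * (-(1 / β) * Real.log (partitionFn β Hl).re - -(1 / β) * Real.log (partitionFn β H₀).re) := by
        field_simp
        ring
      rw [e']
      exact mul_le_mul_of_nonneg_left (by linarith) hβ.le
    exact le_of_mul_le_mul_left (e1.trans e2) hβ
  rw [hφW] at h1
  have hchain : lam * (∑ x : TorusSite d (2 * k), (-1 : ℝ) ^ (∑ j, (x j).val) * (gibbsState β Hl (siteSpin 1 x 2)).re) ≤
      -(lam ^ 2 * E ^ 2 / (2 * (d : ℝ) ^ 2 * (3 * d + lam) * N)) := by nlinarith [h1]
  have hdpos : (0 : ℝ) < d := by exact_mod_cast hd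
  rw [div_le_iff₀ hNpos]
  have hred : -(lam * (E / N) ^ 2 / (2 * (d : ℝ) ^ 2 * (3 * d + lam))) * N =
      -(lam ^ 2 * E ^ 2 / (2 * (d : ℝ) ^ 2 * (3 * d + lam) * N)) / lam := by
    field_simp
  rw [hred, le_div_iff₀ hlam, mul_comm]
  exact hchain

/-- **ALSSY Theorem 3 at positive temperature, density form (densstag).** With `ϱ(x) = ⟨n_x⟩_{β,λ}`
the density in the Gibbs state: `|Λ|⁻¹ |Σ_x (-1)^x ϱ(x)| ≥ λ e(0,β)²/(2d²(3d + λ))` — uniformly in the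
volume, so the density of the infinite system is not constant for `λ ≠ 0` although (for small `λ` and
large `β`, Theorem 1) there is BEC with a constant condensate wave function.
[cite: AizenmanEtAl2004, §4 Theorem 3 (densstag)] [cite: LSSY2005, Ch. 11 Theorem 11.4 (11.45)] -/
theorem hardCoreLatticeGas_thermal_staggeredDensity_abs_ge {k : ℕ} [NeZero (2 * k)] (hk : 2 ≤ k) (hd : 1 ≤ d)
    {lam : ℝ} (hlam : 0 < lam) {β : ℝ} (hβ : 0 < β) :
    lam * ((gibbsState β (xyTorus d (2 * k) 1) (xyTorus d (2 * k) 1)).re / ((2 * k : ℕ) : ℝ) ^ d) ^ 2 /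
        (2 * (d : ℝ) ^ 2 * (3 * d + lam)) ≤
      |(∑ x : TorusSite d (2 * k), (-1 : ℝ) ^ (∑ j, (x j).val) *
          (gibbsState β (hardCoreLatticeGas d (2 * k) lam) (HardCoreBoson.num x)).re) / ((2 * k : ℕ) : ℝ) ^ d| := by
  have hH := hardCoreLatticeGas_isHermitian d (2 * k) lam
  have hZ : partitionFn β (hardCoreLatticeGas d (2 * k) lam) ≠ 0 := (partitionFn_pos β hH).ne'
  have hnum : ∀ x : TorusSite d (2 * k),
      (gibbsState β (hardCoreLatticeGas d (2 * k) lam) (HardCoreBoson.num x)).re =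
        (gibbsState β (hardCoreLatticeGas d (2 * k) lam) (siteSpin 1 x 2)).re + 1 / 2 := by
    intro x
    rw [HardCoreBoson.num_eq, map_add, map_smul, gibbsState_one β _ hZ, Complex.add_re, smul_eq_mul, mul_one]
    norm_num
  have hsum : ∑ x : TorusSite d (2 * k), (-1 : ℝ) ^ (∑ j, (x j).val) *
      (gibbsState β (hardCoreLatticeGas d (2 * k) lam) (HardCoreBoson.num x)).re =
      ∑ x : TorusSite d (2 * k), (-1 : ℝ) ^ (∑ j, (x j).val) *
        (gibbsState β (hardCoreLatticeGas d (2 * k) lam) (siteSpin 1 x 2)).re := by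
    simp only [hnum, mul_add, Finset.sum_add_distrib, ← Finset.sum_mul, sum_stag_eq_zero hd, zero_mul, add_zero]
  rw [hsum]
  have h := hardCoreLatticeGas_thermal_staggeredMagnetisation_le hk hd hlam hβ
  have hnonneg : 0 ≤ lam * ((gibbsState β (xyTorus d (2 * k) 1) (xyTorus d (2 * k) 1)).re / ((2 * k : ℕ) : ℝ) ^ d) ^ 2 /
      (2 * (d : ℝ) ^ 2 * (3 * d + lam)) := by
    positivity
  rw [le_abs]
  right
  linarith

end Thermal

end Literature.MathematicalPhysics.QuantumLattice
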